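import Summits.AtomisticToContinuum.HydrodynamicLimit.Theses.LambertianContactSwap
import Summits.AtomisticToContinuum.HydrodynamicLimit.Theorems.LambertianContactSwapLocalGibbsProbability
import Summits.AtomisticToContinuum.HydrodynamicLimit.Theorems.LambertianContactSwapCollisionMomentBoundBridge
import Literature.MathematicalPhysics.KineticTheory.HardSphereTwoTimePressure
import Summits.AtomisticToContinuum.HydrodynamicLimit.Theorems.LambertianContactSwapContactAngleEquidistributionAbstract
import Summits.AtomisticToContinuum.HydrodynamicLimit.Theorems.LambertianContactSwapContactAngleEquidistributionDomination
import Summits.AtomisticToContinuum.HydrodynamicLimit.Theorems.LambertianContactSwapContactAngleEquidistributionMeas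
import Summits.AtomisticToContinuum.HydrodynamicLimit.Theorems.LambertianContactSwapContactAngleEquidistributionAbstractDV
import Summits.AtomisticToContinuum.HydrodynamicLimit.Theorems.LambertianContactSwapContactAngleEquidistributionNearFieldBall
import Summits.AtomisticToContinuum.HydrodynamicLimit.Theorems.LambertianContactSwapContactAngleEquidistributionEqCentring
import Literature.Analysis.FluidPDE.HardSphereFlowMeasurable
import Literature.MathematicalPhysics.KineticTheory.HardSphereEulerProofs
import Literature.MathematicalPhysics.KineticTheory.HardSphereCanonicalKSLimit
import Summits.AtomisticToContinuum.HydrodynamicLimit.Theorems.LambertianContactSwapContactAngleEquidistributionEqFluxMidSum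
import Summits.AtomisticToContinuum.HydrodynamicLimit.Theorems.LambertianContactSwapContactAngleEquidistributionEqStaticFlux
import Summits.AtomisticToContinuum.HydrodynamicLimit.Theorems.LambertianContactSwapContactAngleEquidistributionEqDumbbellLimit
import Summits.AtomisticToContinuum.HydrodynamicLimit.Theorems.LambertianContactSwapContactAngleEquidistributionEqFluxMoment
import Summits.AtomisticToContinuum.HydrodynamicLimit.Theorems.LambertianContactSwapContactAngleEquidistributionEqCruxTools
import Summits.AtomisticToContinuum.HydrodynamicLimit.Theorems.LambertianContactSwapContactAngleEquidistributionEqCruxSandwich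
import Summits.AtomisticToContinuum.HydrodynamicLimit.Theorems.LambertianContactSwapContactAngleEquidistributionEqCrux
import Literature.MathematicalPhysics.KineticTheory.HardSphereCampbellAssembly
import Literature.MathematicalPhysics.KineticTheory.HardSphereCollisionFluxBackward
import Literature.Analysis.FluidPDE.HardSphereCollisionIntensity
import Literature.Analysis.FluidPDE.HardSphereFlowGroup
import Literature.MathematicalPhysics.KineticTheory.HardSphereCampbellFormulaHolds
import Summits.AtomisticToContinuum.HydrodynamicLimit.Theorems.AntiMazurCoboundariesKineticWindowGronwallBoostRegular
import Summits.AtomisticToContinuum.HydrodynamicLimit.Theorems.AntiMazurCoboundariesKineticWindowGronwallBoostGibbs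
import Summits.AtomisticToContinuum.HydrodynamicLimit.Theorems.LambertianContactSwapContactAngleEquidistributionBoostAlexander
import Summits.AtomisticToContinuum.HydrodynamicLimit.Theorems.LambertianContactSwapContactAngleEquidistributionBoostInstants
import Summits.AtomisticToContinuum.HydrodynamicLimit.Theorems.LambertianContactSwapContactAngleEquidistributionBoostGibbs
import Summits.AtomisticToContinuum.HydrodynamicLimit.Theorems.LambertianContactSwapContactAngleEquidistributionBoostFunctional
import Summits.AtomisticToContinuum.HydrodynamicLimit.Theorems.LambertianContactSwapContactAngleEquidistributionEqConst
import Summits.AtomisticToContinuum.HydrodynamicLimit.Theorems.LambertianContactSwapContactAngleEquidistributionVelTelescope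
import Summits.AtomisticToContinuum.HydrodynamicLimit.Theorems.LambertianContactSwapContactAngleEquidistributionSumRule
import Summits.AtomisticToContinuum.HydrodynamicLimit.Theorems.LambertianContactSwapContactAngleEquidistributionPsiTMeasurable
import Summits.AtomisticToContinuum.HydrodynamicLimit.Theorems.LambertianContactSwapContactAngleEquidistributionPsiTBound
import Summits.AtomisticToContinuum.HydrodynamicLimit.Theorems.LambertianContactSwapContactAngleEquidistributionPsiTLipschitz
import Summits.AtomisticToContinuum.HydrodynamicLimit.Theorems.LambertianContactSwapContactAngleEquidistributionPsiTHit
import Summits.AtomisticToContinuum.HydrodynamicLimit.Theorems.LambertianContactSwapContactAngleEquidistributionVelocityIsotropy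
import Summits.AtomisticToContinuum.HydrodynamicLimit.Theorems.LambertianContactSwapContactAngleEquidistributionLambertWeightedMoment
import Summits.AtomisticToContinuum.HydrodynamicLimit.Theorems.LambertianContactSwapContactAngleEquidistributionLambertMixedMoment
import Summits.AtomisticToContinuum.HydrodynamicLimit.Theorems.LambertianContactSwapContactAngleEquidistributionKappaMeanDq
import Summits.AtomisticToContinuum.HydrodynamicLimit.Theorems.LambertianContactSwapContactAngleEquidistributionTracelessIsotropy
import HarnessLib

/-!
# Line `Sketch` for the crux `ContactAngleEquidistribution` (stmt-AtomisticToContinuum-12097,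
# route LambertianContactSwap, rank 4): the TRANSFER skeleton with the isolated / near-field split

Lead prover `prover-line-stmt-AtomisticToContinuum-12097-0`, 2026-08-16 (v1–v3); continuation lead
`prover-line-stmt-AtomisticToContinuum-12097-c1-0` (v4, 2026-08-16T16:30Z). The ideator's `Sketch.lean`
(evidence `20260816T114205Z-Sketch.lean`) is not readable from the lead's jail, so this skeleton is REBUILT
from the two ideator-1 cards that describe it (`Ideas/angle-bias-is-pesin-defect.md`: `cappedStat`,
`ContactAngleCost`, `CappedCountUI`, `transfer_reduction`; `Ideas/last-flight-cap-pullback.md`: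
`NearFieldBalance`), see `Cruxes/ContactAngleEquidistribution/PICKED.md`.

## v4 (continuation lead): the MIDPOINT-BALL isolation criterion

A collision of the pair `(i, j)` with pre-collisional configuration `y` is NEAR-FIELD iff a third centre lies
within `3ε` of the contact MIDPOINT `x_mid = x_j + ½ sepVec(x_i, x_j)` (v1–v3: within `2ε` of one of the two
colliders). Since `‖x_k − x_mid‖ > 3ε` forces `‖x_k − x_{i/j}‖ > 5ε/2 > 2ε`, the isolated stratum shrinks and the
near-field stratum grows (share still `≍ σ³`, `N`-independent). The point: in the incoming midpoint/normal
coordinates `(x_mid, ω, others, velocities)` of the contact flux (CIP 1994 App. 4.A) the ball criterion, the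
hard-core indicator on the isolated event and the homogeneous Gibbs weight are all `ω`-FREE, so the cosine-flux
integral of the `κ_g`-centred mark vanishes on every fibre (landed centring identity p107962): the equilibrium mean
of the isolated capped functional `A^V_N` is EXACTLY `0` for every `N` (registered sub-goals `stub_campbellTimeDep`,
`stub_fluxMidpoint`, then `stub_costEqCentring`; all conditional on the tree's named fact
`HardSphereCampbellFormula`). With the dumbbell criterion this centring is only `o(1)` through the finite-volume
isotropy of the cavity function, i.e. a canonical cluster expansion. `stub_cost` is now asked with `θe` quantified
before `σ₀` (what the composition uses). The near-field reduction (p111698, dumbbell criterion) is being re-landed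
for the ball criterion (`stub_nearFieldReductionBall`); until then `stub_nearField` is a plain stub again.

## v5 (continuation lead c2, 2026-08-16T20:00Z): the EQUILIBRIUM CRUX as a theorem

Lead c1 left the whole equilibrium defect of the crux in T2'_eq (finite-volume anisotropy of the blocking law,
"`o(1)` by a canonical cluster expansion not in the tree"). The expansion IS in the tree:
`Literature.MathematicalPhysics.KineticTheory.ksInv_eventually` (canonical Kirkwood–Salsburg limit at contact
scale: the normalised pinned probabilities `vcan ε_N (N+1) Y → gLim σ k (lift Y)` uniformly over configurations of
microscopic diameter `≤ L ε_N`, weight `4^{-k}`) and `StatisticalMechanics.HardSphereKS.ksCorr_linearIsometryEquiv`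
/ `ksCorr_const_add` (isometry invariance of `gLim`). New registered sub-goals (section "v5" below):
`stub_eqFluxMidSum` (the outgoing flux of a Gibbs-weighted pre-collisional mark as the sum over `i < j` of
midpoint-fibre integrals — bookkeeping around the landed `stub_fluxMidpoint`), `stub_eqStaticFlux` (for marks
reading only `(x_mid, v_i, v_j, ω)` the `N − 1` spectator positions integrate out to the normalised pinned
probability `vcan ε_N (N+1) (dumbbell x_mid ω)` — the hardest provable stub), `stub_eqDumbbellLimit` (that
dumbbell value tends to a rotation-invariant constant `g₀ ≥ 0` uniformly in `(x_mid, ω)`),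
`stub_eqFluxMoment` (the angular Gaussian cubic moment is finite); lead: the assembly
`stub_eqCrux` (to be landed as `eq_contactAngleEquidistribution`) — under the homogeneous Gibbs law the crux functional's mean tends to `0`
for EVERY admissible `ψ_N` (the Lipschitz modulus in `n` is not needed), conditional on
`HardSphereCampbellFormula` only, with no isolated / near-field split and no speed cap. The non-equilibrium
kernel (`stub_cost`, T1', T2', item 12102) is untouched: it is the open content of the crux as filed.

## v6 (continuation lead c3, 2026-08-16T22:30Z; v6.2 03:10Z: ALL v6 sub-goals LANDED, fact DISCHARGED p130405): DISCHARGE of `HardSphereCampbellFormula`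

The equilibrium crux `stub_eqCrux` (p126260) is conditional on ONE named fact, CIP's special-flow / Campbell identity
`Literature.MathematicalPhysics.KineticTheory.HardSphereCampbellFormula`, already reduced in the tree
(`hardSphereCampbellFormula_dim_of`, p126984) to a lower bound LB (all marks), a sharp upper bound UB (energy-shell marks)
and a.e.-measurability AEM. Section "v6" registers the Literature-side sub-goals of the discharge (they land under
`Literature/MathematicalPhysics/KineticTheory/HardSphereCampbell*.lean`, namespace `Literature.MathematicalPhysics.KineticTheory`):
`pairFlux_swap` + `pairFlux_shell_lt_top` (flux statics), `pairFlux_otherContact_null` (another pair at distance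
exactly `ε` is flux-null), the ENGINE `lintegral_hitPiece_eq_cylinder_last` (a GST hit piece in pre-collision cylinder coordinates,
special pair) with its relabelling covariance `lintegral_hitPiece_comp_perm` / `lintegral_hitPieceCylinder_comp_perm`,
`collisionPairSum_ge_of_mem_hitPiece` (hit-piece dynamics along a flow), `collisionPairSum_windows` /
`collisionPairSum_shellMark` (bookkeeping), `aemeasurable_collisionPairSum` (AEM, lead), `lintegral_ncard_collisionTimes_le_of_hitPiece_volume`
(sharp count bound from a one-window volume bound); lead: `campbell_lowerBound`, `campbell_upperBound`,
`hardSphereCampbellFormula_holds'` and the UNCONDITIONAL equilibrium crux `eq_contactAngleEquidistribution_unconditional`.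

## v7 (continuation lead c4, 2026-08-16T23:40Z): the crux for ALL CONSTANT PROFILES by Galilean covariance

Section "v7" (namespace `…Sketch`, `section Boost`): the unconditional equilibrium theorem is extended from the
rest-frame unit-activity Gibbs law `(1, 0, θ)` to every constant profile `(a, u, θ)`, `a ≠ 0`, `θ > 0`, `u ∈ ℝ³`
(`stub_eqConst`, lead; to be landed as `eq_contactAngleEquidistribution_const`) by exact symmetries: the activity is decorative at fixed `N`
(`KineticWindowGronwallNegative.localGibbsLaw_const_activity`), the drift is the pushforward under the velocity
translation `velShift u` (`KineticWindowGronwallBoost.localGibbsLaw_const_map_velShift_zero`; general profiles: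
registered sub-goal `localGibbsLaw_map_velShift`), and Alexander's construction is boost-covariant (registered
sub-goals `freeExitTime_boostAt`, `incomingPairs_boostAt`, `collisionStep_boostAt`, `stateAfter_boostAt`,
`collisionInstant_boostAt`, `collisionCount_boostAt`, `exitSum_eq_toReal_collisionInstant`,
`collisionInstant_succ_le_of_mem_range`), whence the covariance of the crux functional
(`stub_cruxFunctionalVelShift`, lead; to be landed as `cruxFunctional_velShift`): `D_N[ψ](velShift u z) = D_N[ψ^u](z)` with the boosted — again admissible — test
function `ψ^u(s, x, v, w, n) = ψ(s, x + s u, v + u, w + u, n)`. The open kernel (`stub_cost`, T1', T2', item 12102)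
is untouched; v7.1: all eleven v7 sub-goals LANDED (p131625 p131696 p131850 p132123 p132196), the composition below is ALSO
landed as the bridge theorem `Theorems.ContactAngleEquidistributionSketch.contactAngleEquidistribution_of_kernel` (p132626, tools
p132537: the four open stubs as hypotheses), and the equilibrium layer is unconditional (`costEqCentring_unconditional`,
`nearFieldCosineEq_unconditional`, p132593).

## v8 (continuation lead c5, 2026-08-17T02:40Z): the COLLISION SUM RULE layer and a certified, explicit NECESSARY CONDITION

Sections `SumRule` and `KappaMean` (all fourteen registered sub-goals LANDED this cycle: p134025 p134649 p134099 p133938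
p134016 p133975 p134675 p135112 p134984 p135420 p135504): velocities change only at collisions, so for every velocity
observable the collision sum of the collisional changes telescopes pathwise (`stub_velTelescope`); under EVERY local Gibbs law
(any continuous profiles, `0 < σ < 1/2`, any `Φ`, `t`) the normalised mean of such a sum is `O((N+1)^{-1/3})` for observables
of quadratic growth (`stub_sumRule`: energy conservation + second velocity moment) — the first unconditional statement about the
crux's collision sums OUT of equilibrium. Feeding the crux the admissible collision-difference mark of a quadratic observable
`q_T(v) = ⟪v, T v⟫` (`stub_psiT_*`) and subtracting the sum rule: the crux FORCES
`(N+1)^{-4/3} E_{P_N} Σ_{coll ≤ t} K_{T_N}(vᵢ, vⱼ) → 0` (`stub_velocityIsotropy`), `K_T` the `κ_g`-mean of the collisional change,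
evaluated by the cosine-law moment computations of section `KappaMean` as `K_T = (|g|² tr T − 3⟪g, T g⟫)/6`
(`stub_kappaMean_Dq`); hence the EXPLICIT necessary condition `stub_tracelessIsotropy`: for traceless `T_N`,
`(N+1)^{-4/3} E_{P_N} Σ_{coll ≤ t} ⟪g_k, T_N g_k⟫ → 0` — the collision relative-velocity tensor of the deterministic gas started
from ANY local Gibbs state is asymptotically isotropic at the `N^{4/3}` scale (a local-Maxwellian-in-collision-average statement:
the crux sits behind `BoltzmannHypothesisBarrier` / `DiluteRegimeBarrier`). The open kernel (`stub_cost`, T1', T2', item 12102) is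
untouched and is the line's end state (see `Cruxes/ContactAngleEquidistribution/NOTES.md`, v8 addendum, "The wall").

## The line

The crux asks that under the local Gibbs law `P_N = LG_N` the normalised `|g|²`-weighted collision sum of
`κ_g`-centred admissible marks, `D_N := (N+1)^{-4/3} Σ_{collisions ≤ t} |g|² [ψ_N(ω) − ∫ ψ_N(n) κ_g(dn)]`
(Alexander's collision-by-collision construction), has `E_{LG_N} D_N → 0`.

Split every collision three ways, with a speed cap `V` and the NEAR-FIELD predicate "a third centre lies
within `3ε` of the contact midpoint in the pre-collisional configuration": `D_N = A^V_N + B^V_N + R^V_N`,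
`A` = isolated and `|g| ≤ V`, `B` = near-field and `|g| ≤ V`, `R` = `|g| > V`.

* `stub_tail` (= the route's support item `CollisionMomentBound`, stmt-12102, VERBATIM BY NAME):
  `E_{LG}[(N+1)^{-4/3} Σ (1 + |g|³)] ≤ K` ⟹ `E|R^V_N| ≤ 2K/V`, and integrability of everything.
* `stub_nearField` (the cap-pullback card's `NearFieldBalance`, the crux's irreducible kernel): `E_{LG_N} B^V_N → 0`
  for every `V` — REDUCED (wave 1, p111698, dumbbell criterion) to T1 (admissible-conditioned cosine law) and T2
  (blocking isotropy), both OPEN, XL; the ball-criterion reduction is wave 3.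
* `stub_domination` (provable now; the POINTWISE form of the landed `TransferInequality`, needs `θe > sup θ₀`):
  `LG_N ≤ e^{C(N+1)} G_N` as measures, `G_N` the homogeneous Gibbs law at temperature `θe`.
* `stub_cost` (OPEN — the line's bet; the pesin-defect card's `ContactAngleCost` REPAIRED twice: asked only of the
  isolated capped functional `A` — the full-functional form is false by compressed single-crystal blobs of cost
  `e^{-cδN}`, all of whose collisions are near-field, PICKED.md §3 — and stated in the CLT-scale MGF form that the
  Donsker–Varadhan transfer consumes: `∫ e^{l(N+1)^{4/3}A} dG_N ≤ e^{(N+1)^{4/3}(C l² + δ_N |l|)}`, `δ_N → 0`, `|l| ≤ l₀`).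
* `stub_meas` (provable now): marked collision sums over Alexander's construction are measurable.
* `stub_abstractDV` (provable now, pure measure theory): the Donsker–Varadhan bookkeeping
  `|E_LG D| ≤ C(N+1)^{-1/3}/l + C_A l + δ_N + |E_LG B| + 2K/V`, `l = l_N → 0` slowly, `V := 8K/ε`
  (change of measure `dLG/dG ≤ e^{C(N+1)}` and Jensen for `log`; no second moment of the collision count is
  needed — the cycle-1 `stub_abstract` p105798 / `stub_eqMoment` pair is retired from the composition, the
  equilibrium second moment stays a registered side sub-goal).

The composition `ContactAngleEquidistribution_of` threads the quantifiers (`θe := 1 + sup|θ₀|`,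
`σ₀ := min` of the four thresholds and `1/2`), proves the pointwise split and the pointwise bounds
`|A|,|B| ≤ 2W`, `|R| ≤ 2W/V`, the measurability of the marks, and instantiates `stub_abstractDV`.

## Disproof used
None exists for this crux at the time of writing (`ledger crux ls`: Ideas only, no `Disproof.lean`, no
`_false_without_` theorem, no landed Negative lemma).
-/

noncomputable section

open MeasureTheory Filter Set Topology ProbabilityTheory
open scoped ENNReal BigOperators Classical RealInnerProductSpace

namespace Summit.AtomisticToContinuum.HydrodynamicLimit.Cruxes.ContactAngleEquidistribution.Sketch

open Literature.Analysis.FluidPDE Literature.MathematicalPhysics.KineticTheory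
open Summit.AtomisticToContinuum.HydrodynamicLimit.Theses.LambertianContactSwap

/-! ## Registered stubs (bodies `sorry`; every signature self-contained — the crux's own `let` chain) -/

/-- STUB `cost` (OPEN — the line's bet; RESHAPED at the end of cycle 1 to the CLT-scale MGF form consumed by the
Donsker–Varadhan transfer, which needs no second moment / uniform integrability of the collision count; v4: midpoint-ball
isolation criterion and `θe` quantified before `σ₀`): under the homogeneous Gibbs law `Q_N = localGibbsLaw σ 1 0 θe`, for
admissible marks `ψ_N`, the ISOLATED (no third centre within `3ε` of the contact midpoint) speed-capped `κ_g`-centred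
contact-angle functional `A^V_N` is sub-Gaussian at the CLT scale `(N+1)^{4/3}` around a vanishing mean, uniformly for
`|l| ≤ l₀`: `∫ exp(l (N+1)^{4/3} A^V_N) dQ_N ≤ exp((N+1)^{4/3}(C l² + δ_N |l|))`, `δ_N → 0`, for all large `N`
(card entropy-per-collision-windowed, residual E1_κ, restricted to isolated collisions; by Chebyshev it implies
`Q_N{η < |A^V_N|} ≤ 2e^{-(N+1)^{4/3} η²/(5C)}` eventually — superexponential at speed `N` — i.e. the repaired
`ContactAngleCost` of card angle-bias-is-pesin-defect). Its mean is EXACTLY `0` for every `N` (sub-goal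
`stub_costEqCentring`, conditional on `HardSphereCampbellFormula`); the open content is the concentration. -/
theorem stub_cost :
    let Cfg : ℕ → Type := fun N => Config (N + 1) (Fin 3) T3
    let G := Torus.geometry (Fin 3)
    let ε : ℝ → ℕ → ℝ := hsDiameter
    let τ : ℝ → (N : ℕ) → Cfg N → ℝ≥0∞ := fun σ N z => Alexander.freeExitTime G (ε σ N) z
    let S : ℝ → (N : ℕ) → Cfg N → Cfg N := fun t _ z => freeFlight G t z
    let ldir : V3 → V3 → V3 := fun ω ξ => ‖‖ω‖⁻¹ • ω + ‖ξ‖⁻¹ • ξ‖⁻¹ • (‖ω‖⁻¹ • ω + ‖ξ‖⁻¹ • ξ)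
    let zpre : ℝ → (N : ℕ) → Cfg N → ℕ → Cfg N := fun σ N z m =>
      let y := Alexander.stateAfter G (ε σ N) z m; S (τ σ N y).toReal N y
    let Kt : ℝ → (N : ℕ) → Cfg N → ℝ → ℕ := fun σ N z t => Alexander.collisionCount G (ε σ N) z t
    let hit : ℝ → (N : ℕ) → Cfg N → Fin (N + 1) → Fin (N + 1) → Prop := fun σ N y i j =>
      i < j ∧ y ∈ contactSet G (N + 1) (ε σ N) i j ∧ IsIncoming G y i j
    let tcol : ℝ → (N : ℕ) → Cfg N → ℕ → ℝ := fun σ N z m =>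
      (Alexander.collisionInstant G (ε σ N) z (m + 1)).toReal
    let xmid : (N : ℕ) → Cfg N → Fin (N + 1) → Fin (N + 1) → T3 := fun _ y i j =>
      G.translate (y j).1 ((2 : ℝ)⁻¹ • G.sepVec (y i).1 (y j).1)
    let near : ℝ → (N : ℕ) → Cfg N → Fin (N + 1) → Fin (N + 1) → Prop := fun σ N y i j =>
      ∃ k : Fin (N + 1), k ≠ i ∧ k ≠ j ∧ ‖G.sepVec (y k).1 (xmid N y i j)‖ ≤ 3 * ε σ N
    ∀ θe : ℝ, 0 < θe → ∃ σ₀ : ℝ, 0 < σ₀ ∧ ∀ σ : ℝ, 0 < σ → σ < σ₀ →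
      ∀ Φ : (N : ℕ) → HardSphereFlow G (ε σ N) (N + 1),
      let Q := fun N => localGibbsLaw σ (fun _ => 1) (fun _ => 0) (fun _ => θe) N (Φ N)
      ∀ t : ℝ, 0 ≤ t → ∀ V : ℝ, 0 < V →
      ∀ ψ : ℕ → ℝ → T3 → V3 → V3 → V3 → ℝ,
        (∀ N, Measurable (fun p : ℝ × T3 × V3 × V3 × V3 =>
          ψ N p.1 p.2.1 p.2.2.1 p.2.2.2.1 p.2.2.2.2)) →
        (∀ N s x v w n, |ψ N s x v w n| ≤ 1) →
        (∀ N s x v w (n n' : V3), ‖n‖ = 1 → ‖n'‖ = 1 →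
          |ψ N s x v w n - ψ N s x v w n'| ≤ ‖n - n'‖) →
        ∃ l₀ : ℝ, 0 < l₀ ∧ ∃ C : ℝ, ∃ δ : ℕ → ℝ, Tendsto δ atTop (𝓝 0) ∧ ∀ᶠ N : ℕ in atTop,
          ∀ l : ℝ, |l| ≤ l₀ →
          ∫⁻ z, ENNReal.ofReal (Real.exp (l * ((N : ℝ) + 1) ^ (4 / 3 : ℝ) *
            (((N : ℝ) + 1) ^ (-(4 / 3 : ℝ)) * ∑ m ∈ Finset.range (Kt σ N z t),
            ∑ i : Fin (N + 1), ∑ j : Fin (N + 1),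
              (let y := zpre σ N z m
               if hit σ N y i j then
                 (if near σ N y i j then 0 else if V < ‖(y i).2 - (y j).2‖ then 0 else
                   ‖(y i).2 - (y j).2‖ ^ 2 *
                     (ψ N (tcol σ N z m) (xmid N y i j) (y i).2 (y j).2
                         ((ε σ N)⁻¹ • G.sepVec (y i).1 (y j).1) -
                       ∫ ξ, ψ N (tcol σ N z m) (xmid N y i j) (y i).2 (y j).2
                         (ldir (-((y i).2 - (y j).2)) ξ) ∂(stdGaussian V3)))
               else 0)))) ∂(Q N) ≤
            ENNReal.ofReal (Real.exp (((N : ℝ) + 1) ^ (4 / 3 : ℝ) * (C * l ^ 2 + δ N * |l|))) := by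
  sorry

/-- STUB `domination` (CLOSED — landed in wave 1 as p106196; pointwise form of the landed `TransferInequality`, needs the STRICT
bound `θ₀ < θe`): the local Gibbs law is dominated, as a measure, by `e^{C(N+1)}` times the homogeneous
Gibbs law at temperature `θe` (density ratio `Z_LG⁻¹ Z_G ∏ᵢ a₀ M_{u₀,θ₀}/M_{0,θe} ≤ (K/(a(1−4πσ³/3)))^{N+1}`,
`K = sup a₀ (θe/θ₀)^{3/2} e^{|u₀|²/(2(θe−θ₀))}`). [cite: KipnisLandim1999, App. 1 §8] -/
theorem stub_domination :
    ∀ (a₀ θ₀ : T3 → ℝ) (u₀ : T3 → V3), Continuous a₀ → Continuous θ₀ → Continuous u₀ →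
      (∀ x, 0 < a₀ x) → (∀ x, 0 < θ₀ x) → ∀ θe : ℝ, (∀ x, θ₀ x < θe) →
      ∃ σ₀ : ℝ, 0 < σ₀ ∧ ∀ σ : ℝ, 0 < σ → σ < σ₀ → ∃ C : ℝ, ∀ (N : ℕ)
        (Φ : HardSphereFlow (Torus.geometry (Fin 3)) (hsDiameter σ N) (N + 1)),
        localGibbsLaw σ a₀ u₀ θ₀ N Φ ≤
          ENNReal.ofReal (Real.exp (C * ((N : ℝ) + 1))) •
            localGibbsLaw σ (fun _ => 1) (fun _ => 0) (fun _ => θe) N Φ :=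
  -- LANDED (wave 1, p106196): `Theorems/LambertianContactSwapContactAngleEquidistributionDomination.lean`
  Summit.AtomisticToContinuum.HydrodynamicLimit.Theorems.ContactAngleEquidistributionSketch.stub_domination

/-- STUB `nearFieldCosine` (OPEN, XL — T1' of the ball reduction `stub_nearFieldReductionBall`, p115592; the DYNAMICAL content of the
near-field kernel, `Theorems.ContactAngleEquidistributionSketch.NearFieldAdmissibleCosineLawBall`): under the local Gibbs law the near-field
capped collisions have the cosine law CONDITIONED ON THE ADMISSIBLE (non-overlap) NORMALS in `|g|²`-weighted flux mean. EXACT AT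
EQUILIBRIUM FOR EVERY `N` (sub-goal `stub_nearFieldCosineEq`: fibre identity `stub_fibreAdmissible` p120737 + the exact-centring
principle `integral_hitSum_eq_zero_of_fibre` p119578, conditional on `HardSphereCampbellFormula`); out of equilibrium it is
pre-collisional chaos at the contact scale including the blocking environment (beyond Lanford's time: open). -/
theorem stub_nearFieldCosine :
    Summit.AtomisticToContinuum.HydrodynamicLimit.Theorems.ContactAngleEquidistributionSketch.NearFieldAdmissibleCosineLawBall := by
  sorry

/-- STUB `nearFieldIsotropy` (OPEN, XL — T2' of the ball reduction, the STRUCTURAL content of the near-field kernel,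
`Theorems.ContactAngleEquidistributionSketch.NearFieldBlockingIsotropyBall`): the `1/κ_g(Adm)`-reweighted law of the admissible
(non-overlap) set of normals of near-field collisions given `(s, x, v, w)` is isotropic in flux mean. NOT exact at finite `N` even at
equilibrium (the torus has only cubic symmetry: the whole equilibrium defect of the crux sits here, an `O(σ³)` share times the
finite-volume anisotropy of the blocking law — `o(1)` by correlation decay of the dilute hard-sphere fluid, a canonical cluster
expansion); out of equilibrium: shear-induced anisotropy `∝ Kn` (Lutsko 1996). -/
theorem stub_nearFieldIsotropy :
    Summit.AtomisticToContinuum.HydrodynamicLimit.Theorems.ContactAngleEquidistributionSketch.NearFieldBlockingIsotropyBall := by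
  sorry

/-- `stub_nearField` (= `NearFieldBalanceBall`, the cap-pullback card's kernel for the MIDPOINT-BALL criterion: under the local
Gibbs law the near-field part — a third centre within `3ε` of the contact midpoint — of the capped, `κ_g`-centred, `|g|²`-weighted
contact-angle collision sum has normalised expectation `→ 0`) from T1' and T2': the landed ball reduction
`Theorems.ContactAngleEquidistributionSketch.stub_nearFieldReductionBall` (p115592; pointwise split
`(ψ − κ^adm ψ) + (κ^adm ψ − κψ) = ψ − κψ` and integrability of both marked sums for every `N`). No `sorry` of its own; kept under its
registered name. -/
theorem stub_nearField :
    let Cfg : ℕ → Type := fun N => Config (N + 1) (Fin 3) T3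
    let G := Torus.geometry (Fin 3)
    let ε : ℝ → ℕ → ℝ := hsDiameter
    let τ : ℝ → (N : ℕ) → Cfg N → ℝ≥0∞ := fun σ N z => Alexander.freeExitTime G (ε σ N) z
    let S : ℝ → (N : ℕ) → Cfg N → Cfg N := fun t _ z => freeFlight G t z
    let ldir : V3 → V3 → V3 := fun ω ξ => ‖‖ω‖⁻¹ • ω + ‖ξ‖⁻¹ • ξ‖⁻¹ • (‖ω‖⁻¹ • ω + ‖ξ‖⁻¹ • ξ)
    let zpre : ℝ → (N : ℕ) → Cfg N → ℕ → Cfg N := fun σ N z m =>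
      let y := Alexander.stateAfter G (ε σ N) z m; S (τ σ N y).toReal N y
    let Kt : ℝ → (N : ℕ) → Cfg N → ℝ → ℕ := fun σ N z t => Alexander.collisionCount G (ε σ N) z t
    let hit : ℝ → (N : ℕ) → Cfg N → Fin (N + 1) → Fin (N + 1) → Prop := fun σ N y i j =>
      i < j ∧ y ∈ contactSet G (N + 1) (ε σ N) i j ∧ IsIncoming G y i j
    let tcol : ℝ → (N : ℕ) → Cfg N → ℕ → ℝ := fun σ N z m =>
      (Alexander.collisionInstant G (ε σ N) z (m + 1)).toReal
    let xmid : (N : ℕ) → Cfg N → Fin (N + 1) → Fin (N + 1) → T3 := fun _ y i j =>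
      G.translate (y j).1 ((2 : ℝ)⁻¹ • G.sepVec (y i).1 (y j).1)
    let near : ℝ → (N : ℕ) → Cfg N → Fin (N + 1) → Fin (N + 1) → Prop := fun σ N y i j =>
      ∃ k : Fin (N + 1), k ≠ i ∧ k ≠ j ∧ ‖G.sepVec (y k).1 (xmid N y i j)‖ ≤ 3 * ε σ N
    ∀ (a₀ θ₀ : T3 → ℝ) (u₀ : T3 → V3), Continuous a₀ → Continuous θ₀ → Continuous u₀ →
      (∀ x, 0 < a₀ x) → (∀ x, 0 < θ₀ x) →
      ∃ σ₀ : ℝ, 0 < σ₀ ∧ ∀ σ : ℝ, 0 < σ → σ < σ₀ →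
      ∀ Φ : (N : ℕ) → HardSphereFlow G (ε σ N) (N + 1),
      let P := fun N => localGibbsLaw σ a₀ u₀ θ₀ N (Φ N)
      ∀ t : ℝ, 0 ≤ t → ∀ V : ℝ, 0 < V →
      ∀ ψ : ℕ → ℝ → T3 → V3 → V3 → V3 → ℝ,
        (∀ N, Measurable (fun p : ℝ × T3 × V3 × V3 × V3 =>
          ψ N p.1 p.2.1 p.2.2.1 p.2.2.2.1 p.2.2.2.2)) →
        (∀ N s x v w n, |ψ N s x v w n| ≤ 1) →
        (∀ N s x v w (n n' : V3), ‖n‖ = 1 → ‖n'‖ = 1 →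
          |ψ N s x v w n - ψ N s x v w n'| ≤ ‖n - n'‖) →
        Tendsto (fun N : ℕ => ∫ z, ((N : ℝ) + 1) ^ (-(4 / 3 : ℝ)) *
          ∑ m ∈ Finset.range (Kt σ N z t), ∑ i : Fin (N + 1), ∑ j : Fin (N + 1),
            (let y := zpre σ N z m
             if hit σ N y i j then
               (if near σ N y i j then
                 (if V < ‖(y i).2 - (y j).2‖ then 0 else
                   ‖(y i).2 - (y j).2‖ ^ 2 *
                     (ψ N (tcol σ N z m) (xmid N y i j) (y i).2 (y j).2
                         ((ε σ N)⁻¹ • G.sepVec (y i).1 (y j).1) -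
                       ∫ ξ, ψ N (tcol σ N z m) (xmid N y i j) (y i).2 (y j).2
                         (ldir (-((y i).2 - (y j).2)) ξ) ∂(stdGaussian V3)))
                else 0)
             else 0) ∂(P N)) atTop (𝓝 0) :=
  Summit.AtomisticToContinuum.HydrodynamicLimit.Theorems.ContactAngleEquidistributionSketch.stub_nearFieldReductionBall
    stub_nearFieldCosine stub_nearFieldIsotropy

/-- STUB `tail` = the route's support item `CollisionMomentBound` (stmt-AtomisticToContinuum-12102) BY
NAME: the normalised `|g|³`-weighted collision count has bounded expectation under the local Gibbs law,
uniformly in `N`. Staffed as its own item; imported here as the line's fifth stub. -/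
theorem stub_tail : CollisionMomentBound := by
  sorry

/-- STUB `meas` (CLOSED — landed in wave 1 as p106462): every marked collision sum over Alexander's construction — a measurable real
mark of (collision instant, pre-collisional configuration, ordered pair), read on the `hit`-selected pair of
each of the `collisionCount` collisions in `[0, t]` — is a measurable function of the initial datum
(tree: `Alexander.measurable_collisionCount / _collisionInstant / _stateAfter / _freeExitTime`,
`Torus.isHardSphereRegular_geometry`, `0 < ε ≤ σ < 1/2`). -/
theorem stub_meas :
    let Cfg : ℕ → Type := fun N => Config (N + 1) (Fin 3) T3
    let G := Torus.geometry (Fin 3)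
    let ε : ℝ → ℕ → ℝ := hsDiameter
    let τ : ℝ → (N : ℕ) → Cfg N → ℝ≥0∞ := fun σ N z => Alexander.freeExitTime G (ε σ N) z
    let S : ℝ → (N : ℕ) → Cfg N → Cfg N := fun t _ z => freeFlight G t z
    let zpre : ℝ → (N : ℕ) → Cfg N → ℕ → Cfg N := fun σ N z m =>
      let y := Alexander.stateAfter G (ε σ N) z m; S (τ σ N y).toReal N y
    let Kt : ℝ → (N : ℕ) → Cfg N → ℝ → ℕ := fun σ N z t => Alexander.collisionCount G (ε σ N) z t
    let hit : ℝ → (N : ℕ) → Cfg N → Fin (N + 1) → Fin (N + 1) → Prop := fun σ N y i j =>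
      i < j ∧ y ∈ contactSet G (N + 1) (ε σ N) i j ∧ IsIncoming G y i j
    let tcol : ℝ → (N : ℕ) → Cfg N → ℕ → ℝ := fun σ N z m =>
      (Alexander.collisionInstant G (ε σ N) z (m + 1)).toReal
    ∀ σ : ℝ, 0 < σ → σ < 2⁻¹ → ∀ (N : ℕ) (t : ℝ)
      (f : ℝ → Cfg N → Fin (N + 1) → Fin (N + 1) → ℝ),
      (∀ i j, Measurable (fun p : ℝ × Cfg N => f p.1 p.2 i j)) →
      Measurable (fun z : Cfg N => ∑ m ∈ Finset.range (Kt σ N z t),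
        ∑ i : Fin (N + 1), ∑ j : Fin (N + 1),
          (if hit σ N (zpre σ N z m) i j then f (tcol σ N z m) (zpre σ N z m) i j else 0)) :=
  -- LANDED (wave 1, p106462): `Theorems/LambertianContactSwapContactAngleEquidistributionMeas.lean`
  Summit.AtomisticToContinuum.HydrodynamicLimit.Theorems.ContactAngleEquidistributionSketch.stub_meas

/-- STUB `abstractDV` (CLOSED — landed in wave 2 as p109953; pure measure theory — the Donsker–Varadhan bookkeeping of the transfer,
replacing the cycle-1 `stub_abstract` (landed p105798) whose Cauchy–Schwarz step needed an equilibrium second moment):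
probability measures `μ_N ≤ e^{C(N+1)} ν_N`; `D = A^V + B^V + R^V` with `|A|,|B| ≤ 2W`, `|R| ≤ 2W/V`, `E_μ W ≤ K`;
`E_μ B^V → 0`; and the CLT-scale MGF bound `∫ e^{l(N+1)^{4/3}A} dν ≤ e^{(N+1)^{4/3}(C_A l² + δ_N|l|)}`, `δ_N → 0`, for
`|l| ≤ l₀`.  Then `E_μ D → 0`: change of measure and Jensen for `log`,
`l c ∫A dμ ≤ log‖dμ/dν‖_∞ + log ∫ e^{l c A} dν ≤ C(N+1) + c(C_A l² + δ_N l)` (`c = (N+1)^{4/3}`, both signs of `l`), so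
`|∫A dμ| ≤ C(N+1)^{-1/3}/l + C_A l + δ_N → 0` along `l = l_N → 0` slowly; `|∫R| ≤ 2K/V`, `∫B → 0`. -/
theorem stub_abstractDV {α : ℕ → Type*} [∀ N, MeasurableSpace (α N)]
    (μ ν : (N : ℕ) → Measure (α N)) (hμ : ∀ N, IsProbabilityMeasure (μ N))
    (hν : ∀ N, IsProbabilityMeasure (ν N))
    (D W : (N : ℕ) → α N → ℝ) (A B R : ℝ → (N : ℕ) → α N → ℝ)
    (hD : ∀ V, 0 < V → ∀ N z, D N z = A V N z + B V N z + R V N z)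
    (hAm : ∀ V, 0 < V → ∀ N, Measurable (A V N)) (hBm : ∀ V, 0 < V → ∀ N, Measurable (B V N))
    (hRm : ∀ V, 0 < V → ∀ N, Measurable (R V N)) (hWm : ∀ N, Measurable (W N)) (hW0 : ∀ N z, 0 ≤ W N z)
    (hW : ∃ K : ℝ, ∀ N, ∫⁻ z, ENNReal.ofReal (W N z) ∂μ N ≤ ENNReal.ofReal K)
    (hAW : ∀ V, 0 < V → ∀ N z, |A V N z| ≤ 2 * W N z)
    (hBW : ∀ V, 0 < V → ∀ N z, |B V N z| ≤ 2 * W N z)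
    (hRW : ∀ V, 0 < V → ∀ N z, |R V N z| ≤ 2 / V * W N z)
    (hdom : ∃ C : ℝ, ∀ N, μ N ≤ ENNReal.ofReal (Real.exp (C * ((N : ℝ) + 1))) • ν N)
    (hmgf : ∀ V, 0 < V → ∃ l₀ : ℝ, 0 < l₀ ∧ ∃ C : ℝ, ∃ δ : ℕ → ℝ, Tendsto δ atTop (𝓝 0) ∧
      ∀ᶠ N : ℕ in atTop, ∀ l : ℝ, |l| ≤ l₀ →
        ∫⁻ z, ENNReal.ofReal (Real.exp (l * ((N : ℝ) + 1) ^ (4 / 3 : ℝ) * A V N z)) ∂ν N ≤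
          ENNReal.ofReal (Real.exp (((N : ℝ) + 1) ^ (4 / 3 : ℝ) * (C * l ^ 2 + δ N * |l|))))
    (hnear : ∀ V, 0 < V → Tendsto (fun N => ∫ z, B V N z ∂μ N) atTop (𝓝 0)) :
    Tendsto (fun N => ∫ z, D N z ∂μ N) atTop (𝓝 0) :=
  -- LANDED (wave 2, p109953): `Theorems/LambertianContactSwapContactAngleEquidistributionAbstractDV.lean`
  Summit.AtomisticToContinuum.HydrodynamicLimit.Theorems.ContactAngleEquidistributionSketch.stub_abstractDV μ ν hμ hν
    D W A B R hD hAm hBm hRm hWm hW0 hW hAW hBW hRW hdom hmgf hnear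

/-! ## v5: the EQUILIBRIUM CRUX (registered sub-goals + the lead's assembly)

Under the homogeneous Gibbs law `Q_N = localGibbsLaw σ 1 0 θ N (Φ N)` the mean of the crux functional
`D_N = (N+1)^{-4/3} Σ_{collisions ≤ t} |g|² [ψ_N(s, x_mid, vᵢ, vⱼ, ω) − κ_g ψ_N]` tends to `0`:
Campbell (`stub_campbellTimeDep`, p116914) writes `E_Q[hit-sum of F^±]` as a time integral of outgoing fluxes;
`stub_eqFluxMidSum` + `stub_eqStaticFlux` turn each flux into
`Σ_{i<j} ∫dx ∫dv dw M(v)M(w) ∫_{S²} dω (ε²⟪ω, w − v⟫)₊ Ψ^±(x,v,w,ω) · vcan ε (N+1) (dumbbell x ω)`;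
`stub_eqDumbbellLimit` replaces `vcan (dumbbell)` by a constant `g₀` up to `δ`, uniformly; with the constant the
`ω`-integrals of `Ψ⁺` and `Ψ⁻` agree (`fibre_lintegral_cosFlux_mark_pos_eq_neg`, p118331); the remainder is
`≤ 2δ t · (N+1)^{-4/3} · #{i<j} · ε² · 2 · (angular cubic Gaussian moment)` `≤ 2δ t σ² K`
(`stub_eqFluxMoment`, `rpow_mul_sq_mul_hsDiameter_sq`). -/

/-- STUB `eqFluxMidSum` (v5, CLOSED — landed p123349; bookkeeping around the landed `stub_fluxMidpoint` p117575, cf. the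
proof of `outgoingCollisionFlux_pre_congr` p119578): for `0 < σ < 1/2`, every `θ`, `N` and every measurable
`ℝ≥0∞`-valued mark `F (y, i, j)` of (pre-collisional configuration, ordered pair), the outgoing collision flux of
the Gibbs-weighted transported mark `ρ_N(w) · [i < j] F (collidePair i j w, i, j)` is the sum over `i < j` of the
midpoint-fibre integrals `∫ dz ∫_{S²} dω (ε²⟪ω, v_j − v_i⟫)₊ (1_D ρ_N F(·, i, j))(mid z i j ω)`, where
`mid z i j ω` puts particle `i` at `x_j + (ε/2)ω` and particle `j` at `x_j − (ε/2)ω` (velocities unchanged): the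
Gibbs weight is invariant under the elastic reflection (`canonicalDensity_collidePair_const`) and
`stub_fluxMidpoint` applies pair by pair. [cite: CIP1994, App. 4.A pp. 107–111] -/
theorem stub_eqFluxMidSum {σ : ℝ} (hσ : 0 < σ) (hσh : σ < 1 / 2) (θ : ℝ) (N : ℕ)
    (F : Config (N + 1) (Fin 3) T3 → Fin (N + 1) → Fin (N + 1) → ℝ≥0∞)
    (hF : ∀ i j, Measurable fun y => F y i j) :
    outgoingCollisionFlux (hsDiameter σ N) (N + 1) (fun w i j =>
        ENNReal.ofReal (canonicalDensity (Torus.geometry (Fin 3)) (hsDiameter σ N) (N + 1)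
          (localGibbsProfile (fun _ => 1) (fun _ => 0) (fun _ => θ)) w) *
        (if i < j then F (collidePair (Torus.geometry (Fin 3)) i j w) i j else 0)) =
      ∑ i : Fin (N + 1), ∑ j : Fin (N + 1), if i < j then
        ∫⁻ z : Config (N + 1) (Fin 3) T3, ∫⁻ ω : Metric.sphere (0 : V3) 1,
          ENNReal.ofReal (hsDiameter σ N ^ (Fintype.card (Fin 3) - 1) * ⟪((ω : V3)), (z j).2 - (z i).2⟫) *
            (hardSphereDomain (Torus.geometry (Fin 3)) (N + 1) (hsDiameter σ N)).indicator
              (fun y => ENNReal.ofReal (canonicalDensity (Torus.geometry (Fin 3)) (hsDiameter σ N) (N + 1)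
                (localGibbsProfile (fun _ => 1) (fun _ => 0) (fun _ => θ)) y) * F y i j)
              (Function.update (Function.update z i
                  ((z j).1 + Literature.Analysis.FunctionSpaces.Torus.proj ((hsDiameter σ N / 2) • (ω : V3)),
                    (z i).2)) j
                ((z j).1 + Literature.Analysis.FunctionSpaces.Torus.proj (-((hsDiameter σ N / 2) • (ω : V3))),
                  (z j).2))
          ∂(volume : Measure V3).toSphere
        else 0 :=
  -- LANDED (wave 1, v5)
  Summit.AtomisticToContinuum.HydrodynamicLimit.Theorems.ContactAngleEquidistributionSketch.stub_eqFluxMidSum hσ hσh θ N F hF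

/-- STUB `eqStaticFlux` (v5, CLOSED — landed p124922 with tools p124766; the hardest provable stub; statics of the canonical ensemble):
INTEGRATING OUT THE SPECTATORS. For `0 < σ < 1/2`, `θ > 0`, `i ≠ j` and a measurable `ℝ≥0∞`-valued mark
`Ψ (x_mid, v_i, v_j, n)` reading only the contact midpoint, the two incoming velocities and the contact normal,
the midpoint-fibre integral of `1_D ρ_N Ψ` equals
`∫ dx ∫ dv ∫ dw ∫_{S²} dω (ε²⟪ω, w − v⟫)₊ M_θ(v) M_θ(w) Ψ(x, v, w, ω) · vcan ε (N+1) (x + (ε/2)ω, x − (ε/2)ω)`: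
on the fibre the pair separation is `εω` (so the midpoint is `x_j =: x` and the normal is `ω`,
`fibre_sepVec_add_proj_add_proj`), the discarded position `x_i` integrates to `1`, the `N − 1` spectator
Maxwellians integrate to `1`, the spectator positions integrate to the pinned hard-core probability
`pinnedXi ε (dumbbell) (N − 1)` of `HardSphereCanonicalKS`, and the normalisation `𝒵_N` of `canonicalDensity`
is `XiT ε (N+1)` (`canonicalPartition_eq_posPartition`), whence `vcan = pinnedXi / XiT`.
[cite: PulvirentiTsagkarogiannis2012, §3, §5] -/
theorem stub_eqStaticFlux {σ : ℝ} (hσ : 0 < σ) (hσh : σ < 1 / 2) {θ : ℝ} (hθ : 0 < θ) {N : ℕ}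
    {i j : Fin (N + 1)} (hij : i ≠ j) (Ψ : T3 → V3 → V3 → V3 → ℝ≥0∞)
    (hΨ : Measurable fun p : T3 × V3 × V3 × V3 => Ψ p.1 p.2.1 p.2.2.1 p.2.2.2) :
    ∫⁻ z : Config (N + 1) (Fin 3) T3, ∫⁻ ω : Metric.sphere (0 : V3) 1,
        ENNReal.ofReal (hsDiameter σ N ^ (Fintype.card (Fin 3) - 1) * ⟪((ω : V3)), (z j).2 - (z i).2⟫) *
          (hardSphereDomain (Torus.geometry (Fin 3)) (N + 1) (hsDiameter σ N)).indicator
            (fun y => ENNReal.ofReal (canonicalDensity (Torus.geometry (Fin 3)) (hsDiameter σ N) (N + 1)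
                (localGibbsProfile (fun _ => 1) (fun _ => 0) (fun _ => θ)) y) *
              Ψ ((Torus.geometry (Fin 3)).translate (y j).1
                  ((2 : ℝ)⁻¹ • (Torus.geometry (Fin 3)).sepVec (y i).1 (y j).1))
                (y i).2 (y j).2 ((hsDiameter σ N)⁻¹ • (Torus.geometry (Fin 3)).sepVec (y i).1 (y j).1))
            (Function.update (Function.update z i
                ((z j).1 + Literature.Analysis.FunctionSpaces.Torus.proj ((hsDiameter σ N / 2) • (ω : V3)),
                  (z i).2)) j
              ((z j).1 + Literature.Analysis.FunctionSpaces.Torus.proj (-((hsDiameter σ N / 2) • (ω : V3))),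
                (z j).2))
        ∂(volume : Measure V3).toSphere =
      ∫⁻ x : T3, ∫⁻ v : V3, ∫⁻ w : V3, ∫⁻ ω : Metric.sphere (0 : V3) 1,
        ENNReal.ofReal (hsDiameter σ N ^ (Fintype.card (Fin 3) - 1) * ⟪((ω : V3)), w - v⟫) *
          ENNReal.ofReal (localMaxwellian 1 θ 0 v * localMaxwellian 1 θ 0 w) * Ψ x v w ω *
            ENNReal.ofReal (vcan (hsDiameter σ N) (N + 1)
              ![x + Literature.Analysis.FunctionSpaces.Torus.proj ((hsDiameter σ N / 2) • (ω : V3)),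
                x + Literature.Analysis.FunctionSpaces.Torus.proj (-((hsDiameter σ N / 2) • (ω : V3)))])
        ∂(volume : Measure V3).toSphere :=
  -- LANDED (wave 1, v5)
  Summit.AtomisticToContinuum.HydrodynamicLimit.Theorems.ContactAngleEquidistributionSketch.stub_eqStaticFlux hσ hσh hθ hij Ψ hΨ

/-- STUB `eqDumbbellLimit` (v5, CLOSED — landed p125156; the canonical Kirkwood–Salsburg limit at contact scale): at small
reduced density the normalised pinned probability of a CONTACT DUMBBELL, `vcan ε_N (N+1) (x + (ε_N/2)ω, x − (ε_N/2)ω)`,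
converges as `N → ∞` to a constant `g₀ ≥ 0` (the contact value `gLim σ 2 (e/2, −e/2)` of Ruelle's infinite-volume pair
correlation, the same for every unit `e` by `HardSphereKS.ksCorr_linearIsometryEquiv`), UNIFORMLY in the midpoint
`x ∈ 𝕋³` and the unit normal `ω` (`ksInv_eventually` with window `L = 1`, `k = 2`; the lift of the dumbbell about
`x` is `(ω/2, −ω/2)`; `g₀ ≥ 0` because `vcan ≥ 0`). [cite: Ruelle1969, §4.2.3 Thm 4.2.3; PulvirentiTsagkarogiannis2012, Thm 2.1] -/
theorem stub_eqDumbbellLimit {σ : ℝ} (h : SmallDensity uniformProfile σ) :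
    ∃ g₀ : ℝ, 0 ≤ g₀ ∧ ∀ δ : ℝ, 0 < δ → ∀ᶠ N : ℕ in atTop, ∀ (x : T3) (ω : V3), ‖ω‖ = 1 →
      |vcan (hsDiameter σ N) (N + 1)
          ![x + Literature.Analysis.FunctionSpaces.Torus.proj ((hsDiameter σ N / 2) • ω),
            x + Literature.Analysis.FunctionSpaces.Torus.proj (-((hsDiameter σ N / 2) • ω))] - g₀| ≤ δ :=
  -- LANDED (wave 1, v5)
  Summit.AtomisticToContinuum.HydrodynamicLimit.Theorems.ContactAngleEquidistributionSketch.stub_eqDumbbellLimit h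

/-- STUB `eqFluxMoment` (v5, CLOSED — landed p125334; Gaussian moments): the ANGULAR CUBIC FLUX MOMENT of two independent
Maxwellian velocities is finite, `∫ dv ∫ dw ∫_{S²} dω (⟪ω, w − v⟫)₊ M_θ(v) M_θ(w) ‖v − w‖² ≤ K(θ) < ∞`
(`= π ∫∫ M M ‖v − w‖³` by `integral_posInner_sphere`; quartic Gaussian moments, cf. `lintegral_cubicFluxMoment_ne_top`).
[folklore] -/
theorem stub_eqFluxMoment {θ : ℝ} (hθ : 0 < θ) :
    ∃ K : ℝ, ∫⁻ v : V3, ∫⁻ w : V3, ∫⁻ ω : Metric.sphere (0 : V3) 1,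
        ENNReal.ofReal ⟪((ω : V3)), w - v⟫ * ENNReal.ofReal (localMaxwellian 1 θ 0 v * localMaxwellian 1 θ 0 w) *
          ENNReal.ofReal (‖v - w‖ ^ 2) ∂(volume : Measure V3).toSphere ≤ ENNReal.ofReal K :=
  -- LANDED (wave 1, v5)
  Summit.AtomisticToContinuum.HydrodynamicLimit.Theorems.ContactAngleEquidistributionSketch.stub_eqFluxMoment hθ

/-- STUB `eqCruxParts` (v5, lead, CLOSED — landed p126090 `…EqCruxTools.lean`; generic): `|∫ f| ≤ C` by positive /
negative parts, the bridge from the two Campbell identities to the Bochner mean of the signed mark. [folklore] -/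
theorem stub_eqCruxParts {α : Type*} [MeasurableSpace α] {μ : Measure α} {f g₁ g₂ W : α → ℝ}
    (hW : ∫⁻ z, ENNReal.ofReal (W z) ∂μ ≠ ⊤) (h₁m : Measurable g₁) (h₂m : Measurable g₂)
    (hWm : Measurable W) (c : ℝ) (hW0 : ∀ z, 0 ≤ W z) (h₁W : ∀ z, |g₁ z| ≤ c * W z)
    (h₂W : ∀ z, |g₂ z| ≤ c * W z) (h₁0 : ∀ z, 0 ≤ g₁ z) (h₂0 : ∀ z, 0 ≤ g₂ z)
    (hf : ∀ z, f z = g₁ z - g₂ z) {C : ℝ}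
    (h : |(∫⁻ z, ENNReal.ofReal (g₁ z) ∂μ).toReal - (∫⁻ z, ENNReal.ofReal (g₂ z) ∂μ).toReal| ≤ C) :
    |∫ z, f z ∂μ| ≤ C :=
  Summit.AtomisticToContinuum.HydrodynamicLimit.Theorems.ContactAngleEquidistributionSketch.EqCrux.stub_eqCruxParts hW h₁m h₂m hWm c hW0 h₁W h₂W h₁0 h₂0 hf h

/-- STUB `eqCruxSandwich` (v5, lead, CLOSED — landed p126129; the STATIC SANDWICH consumed by `stub_eqCrux`): for the positive /
negative parts of the centred mark, the static functionals produced by `stub_eqStaticFlux` differ by at most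
`4δε²K` whenever the contact-dumbbell correlation is within `δ` of a constant `g₀ ≥ 0` (`stub_eqDumbbellLimit`) and
the angular cubic Gaussian flux moment is `≤ K` (`stub_eqFluxMoment`); both are `≤ (g₀+δ)2ε²K`. With the constant
in place of `vcan` the two functionals agree fibre by fibre (`fibre_lintegral_cosFlux_mark_pos_eq_neg`).
[cite: CIP1994, App. 4.A pp. 107–111] -/
theorem stub_eqCruxSandwich {σ : ℝ} (hσ : 0 < σ) (θ : ℝ) (N : ℕ)
    (ψ : ℕ → ℝ → T3 → V3 → V3 → V3 → ℝ)
    (hψm : ∀ N, Measurable (fun p : ℝ × T3 × V3 × V3 × V3 =>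
      ψ N p.1 p.2.1 p.2.2.1 p.2.2.2.1 p.2.2.2.2))
    (hψb : ∀ N s x v w n, |ψ N s x v w n| ≤ 1) (s : ℝ) {g₀ δ K : ℝ} (hg₀ : 0 ≤ g₀) (hδ : 0 ≤ δ)
    (hV : ∀ (x : T3) (ω : V3), ‖ω‖ = 1 →
      |vcan (hsDiameter σ N) (N + 1)
          ![x + Literature.Analysis.FunctionSpaces.Torus.proj ((hsDiameter σ N / 2) • ω),
            x + Literature.Analysis.FunctionSpaces.Torus.proj (-((hsDiameter σ N / 2) • ω))] - g₀| ≤ δ)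
    (hK : ∫⁻ v : V3, ∫⁻ w : V3, ∫⁻ ω : Metric.sphere (0 : V3) 1,
        ENNReal.ofReal ⟪((ω : V3)), w - v⟫ *
          ENNReal.ofReal (localMaxwellian 1 θ 0 v * localMaxwellian 1 θ 0 w) *
          ENNReal.ofReal (‖v - w‖ ^ 2) ∂(volume : Measure V3).toSphere ≤ ENNReal.ofReal K) :
    let Stat : (T3 → V3 → V3 → V3 → ℝ≥0∞) → ℝ≥0∞ := fun Ψ =>
      ∫⁻ x : T3, ∫⁻ v : V3, ∫⁻ w : V3, ∫⁻ ω : Metric.sphere (0 : V3) 1,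
        ENNReal.ofReal (hsDiameter σ N ^ (Fintype.card (Fin 3) - 1) * ⟪((ω : V3)), w - v⟫) *
          ENNReal.ofReal (localMaxwellian 1 θ 0 v * localMaxwellian 1 θ 0 w) * Ψ x v w ω *
            ENNReal.ofReal (vcan (hsDiameter σ N) (N + 1)
              ![x + Literature.Analysis.FunctionSpaces.Torus.proj ((hsDiameter σ N / 2) • (ω : V3)),
                x + Literature.Analysis.FunctionSpaces.Torus.proj (-((hsDiameter σ N / 2) • (ω : V3)))])
        ∂(volume : Measure V3).toSphere
    let mark : ℝ → T3 → V3 → V3 → V3 → ℝ≥0∞ := fun c x v w n =>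
      ENNReal.ofReal (max (c * (‖v - w‖ ^ 2 *
        (ψ N s x v w n -
          ∫ ξ, ψ N s x v w
            (‖‖-(v - w)‖⁻¹ • (-(v - w)) + ‖ξ‖⁻¹ • ξ‖⁻¹ • (‖-(v - w)‖⁻¹ • (-(v - w)) + ‖ξ‖⁻¹ • ξ))
            ∂(stdGaussian V3)))) 0)
    Stat (mark 1) ≤ Stat (mark (-1)) +
        ENNReal.ofReal (4 * δ * hsDiameter σ N ^ (Fintype.card (Fin 3) - 1) * K) ∧
      Stat (mark (-1)) ≤ Stat (mark 1) +
        ENNReal.ofReal (4 * δ * hsDiameter σ N ^ (Fintype.card (Fin 3) - 1) * K) ∧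
      Stat (mark 1) ≤ ENNReal.ofReal ((g₀ + δ) * (2 * hsDiameter σ N ^ (Fintype.card (Fin 3) - 1) * K)) ∧
      Stat (mark (-1)) ≤
        ENNReal.ofReal ((g₀ + δ) * (2 * hsDiameter σ N ^ (Fintype.card (Fin 3) - 1) * K)) :=
  -- LANDED (lead, v5): p126129 `Theorems/LambertianContactSwapContactAngleEquidistributionEqCruxSandwich.lean`
  Summit.AtomisticToContinuum.HydrodynamicLimit.Theorems.ContactAngleEquidistributionSketch.EqCrux.stub_eqCruxSandwich hσ θ N ψ hψm hψb s hg₀ hδ hV hK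

/-- STUB `eqCrux` = **the EQUILIBRIUM CRUX** (v5, lead, CLOSED — landed p126260; the assembly of the four `eq` stubs with the landed Campbell layer):
conditional on the named fact `HardSphereCampbellFormula`, for every temperature `θ > 0` there is `σ₀ > 0` such that
for all `0 < σ < σ₀`, all families of hard-sphere flow structures `Φ`, all `t ≥ 0` and ALL admissible test
functions `ψ_N (s, x, v, v_*, n)` (jointly measurable, `|ψ_N| ≤ 1`; no modulus of continuity in `n` is needed),
the mean under the homogeneous Gibbs law `Q_N = localGibbsLaw σ 1 0 θ N (Φ N)` of the crux functional — the
normalised `|g|²`-weighted collision sum of `κ_g`-centred marks over Alexander's construction, VERBATIM the body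
of `ContactAngleEquidistribution` — tends to `0` as `N → ∞`: contact-normal equidistribution given the pair holds
at equilibrium at fixed reduced density (the one-sided molecular-chaos / Enskog closure for the impact parameter,
Pagonabarraga–Trizac–van Noije–Ernst 2001, is exact in the infinite-volume limit of the canonical Gibbs state;
the finite-`N` defect is the cubic anisotropy of the contact dumbbell correlation on `𝕋³`, killed by the
canonical Kirkwood–Salsburg limit). [cite: CIP1994, App. 4.A pp. 107–111; Ruelle1969, §4.2.3 Thm 4.2.3] -/
theorem stub_eqCrux (hC : HardSphereCampbellFormula) :
    let Cfg : ℕ → Type := fun N => Config (N + 1) (Fin 3) T3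
    let G := Torus.geometry (Fin 3)
    let ε : ℝ → ℕ → ℝ := hsDiameter
    let τ : ℝ → (N : ℕ) → Cfg N → ℝ≥0∞ := fun σ N z => Alexander.freeExitTime G (ε σ N) z
    let S : ℝ → (N : ℕ) → Cfg N → Cfg N := fun t _ z => freeFlight G t z
    let ldir : V3 → V3 → V3 := fun ω ξ => ‖‖ω‖⁻¹ • ω + ‖ξ‖⁻¹ • ξ‖⁻¹ • (‖ω‖⁻¹ • ω + ‖ξ‖⁻¹ • ξ)
    let zpre : ℝ → (N : ℕ) → Cfg N → ℕ → Cfg N := fun σ N z m =>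
      let y := Alexander.stateAfter G (ε σ N) z m; S (τ σ N y).toReal N y
    let Kt : ℝ → (N : ℕ) → Cfg N → ℝ → ℕ := fun σ N z t => Alexander.collisionCount G (ε σ N) z t
    let hit : ℝ → (N : ℕ) → Cfg N → Fin (N + 1) → Fin (N + 1) → Prop := fun σ N y i j =>
      i < j ∧ y ∈ contactSet G (N + 1) (ε σ N) i j ∧ IsIncoming G y i j
    let tcol : ℝ → (N : ℕ) → Cfg N → ℕ → ℝ := fun σ N z m =>
      (Alexander.collisionInstant G (ε σ N) z (m + 1)).toReal
    let xmid : (N : ℕ) → Cfg N → Fin (N + 1) → Fin (N + 1) → T3 := fun _ y i j =>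
      G.translate (y j).1 ((2 : ℝ)⁻¹ • G.sepVec (y i).1 (y j).1)
    ∀ θ : ℝ, 0 < θ → ∃ σ₀ : ℝ, 0 < σ₀ ∧ ∀ σ : ℝ, 0 < σ → σ < σ₀ →
      ∀ Φ : (N : ℕ) → HardSphereFlow G (ε σ N) (N + 1),
      let Q := fun N => localGibbsLaw σ (fun _ => 1) (fun _ => 0) (fun _ => θ) N (Φ N)
      ∀ t : ℝ, 0 ≤ t → ∀ ψ : ℕ → ℝ → T3 → V3 → V3 → V3 → ℝ,
        (∀ N, Measurable (fun p : ℝ × T3 × V3 × V3 × V3 =>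
          ψ N p.1 p.2.1 p.2.2.1 p.2.2.2.1 p.2.2.2.2)) →
        (∀ N s x v w n, |ψ N s x v w n| ≤ 1) →
        Tendsto (fun N : ℕ => ∫ z, ((N : ℝ) + 1) ^ (-(4 / 3 : ℝ)) *
          ∑ m ∈ Finset.range (Kt σ N z t), ∑ i : Fin (N + 1), ∑ j : Fin (N + 1),
            (let y := zpre σ N z m
             if hit σ N y i j then
               ‖(y i).2 - (y j).2‖ ^ 2 *
                 (ψ N (tcol σ N z m) (xmid N y i j) (y i).2 (y j).2 ((ε σ N)⁻¹ • G.sepVec (y i).1 (y j).1) -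
                   ∫ ξ, ψ N (tcol σ N z m) (xmid N y i j) (y i).2 (y j).2 (ldir (-((y i).2 - (y j).2)) ξ)
                     ∂(stdGaussian V3))
             else 0) ∂(Q N)) atTop (𝓝 0) :=
  -- LANDED (lead, v5): p126260 `Theorems/LambertianContactSwapContactAngleEquidistributionEqCrux.lean`
  Summit.AtomisticToContinuum.HydrodynamicLimit.Theorems.ContactAngleEquidistributionSketch.stub_eqCrux hC

/-! ## Generic helpers for the composition (no hard-sphere object appears; `Decidable` instances are
implicit ARGUMENTS, filled by unification, so that the lemmas apply whatever instances the route file and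
this file synthesised) -/

/-- Three-way split of a selected summand: isolated-capped + near-capped + fast. [folklore] -/
theorem ite_split3 {p q r : Prop} {ip₀ ip₁ ip₂ ip₃ : Decidable p} {iq₁ iq₂ : Decidable q}
    {ir₁ ir₂ ir₃ : Decidable r} {s : ℝ} :
    @ite _ p ip₀ s 0 =
      @ite _ p ip₁ (@ite _ q iq₁ 0 (@ite _ r ir₁ 0 s)) 0 +
        @ite _ p ip₂ (@ite _ q iq₂ (@ite _ r ir₂ 0 s) 0) 0 +
          @ite _ p ip₃ (@ite _ r ir₃ s 0) 0 := by
  split_ifs <;> ring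

/-- Splitting a scaled triple sum along a termwise three-way split. [folklore] -/
theorem mul_sum3_split {ι : Type*} (K : Finset ι) (n : ℕ) (c : ℝ)
    (f a b r : ι → Fin n → Fin n → ℝ) (h : ∀ m i j, f m i j = a m i j + b m i j + r m i j) :
    c * ∑ m ∈ K, ∑ i : Fin n, ∑ j : Fin n, f m i j =
      c * ∑ m ∈ K, ∑ i : Fin n, ∑ j : Fin n, a m i j +
        c * ∑ m ∈ K, ∑ i : Fin n, ∑ j : Fin n, b m i j +
          c * ∑ m ∈ K, ∑ i : Fin n, ∑ j : Fin n, r m i j := by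
  rw [← mul_add, ← mul_add, ← Finset.sum_add_distrib, ← Finset.sum_add_distrib]
  congr 1
  refine Finset.sum_congr rfl fun m _ => ?_
  rw [← Finset.sum_add_distrib, ← Finset.sum_add_distrib]
  refine Finset.sum_congr rfl fun i _ => ?_
  rw [← Finset.sum_add_distrib, ← Finset.sum_add_distrib]
  exact Finset.sum_congr rfl fun j _ => h m i j

/-- Nonnegativity of a scaled triple sum of nonnegative terms. [folklore] -/
theorem mul_sum3_nonneg {ι : Type*} (K : Finset ι) (n : ℕ) {c : ℝ} (hc : 0 ≤ c)
    (f : ι → Fin n → Fin n → ℝ) (h : ∀ m i j, 0 ≤ f m i j) :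
    0 ≤ c * ∑ m ∈ K, ∑ i : Fin n, ∑ j : Fin n, f m i j :=
  mul_nonneg hc (Finset.sum_nonneg fun m _ => Finset.sum_nonneg fun i _ =>
    Finset.sum_nonneg fun j _ => h m i j)

/-- Termwise domination of a scaled triple sum. [folklore] -/
theorem abs_mul_sum3_le {ι : Type*} (K : Finset ι) (n : ℕ) {c : ℝ} (hc : 0 ≤ c) (κ : ℝ)
    (f g : ι → Fin n → Fin n → ℝ) (h : ∀ m i j, |f m i j| ≤ κ * g m i j) :
    |c * ∑ m ∈ K, ∑ i : Fin n, ∑ j : Fin n, f m i j| ≤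
      κ * (c * ∑ m ∈ K, ∑ i : Fin n, ∑ j : Fin n, g m i j) := by
  rw [abs_mul, abs_of_nonneg hc, mul_left_comm, Finset.mul_sum]
  refine mul_le_mul_of_nonneg_left ?_ hc
  refine (Finset.abs_sum_le_sum_abs _ _).trans (Finset.sum_le_sum fun m _ => ?_)
  rw [Finset.mul_sum]
  refine (Finset.abs_sum_le_sum_abs _ _).trans (Finset.sum_le_sum fun i _ => ?_)
  rw [Finset.mul_sum]
  exact (Finset.abs_sum_le_sum_abs _ _).trans (Finset.sum_le_sum fun j _ => h m i j)

/-- `x² ≤ 1 + x³` for `x ≥ 0`. [folklore] -/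
theorem sq_le_one_add_pow_three {x : ℝ} (hx : 0 ≤ x) : x ^ 2 ≤ 1 + x ^ 3 := by
  rcases le_or_gt x 1 with h | h
  · nlinarith [mul_le_one₀ h hx h, pow_nonneg hx 3]
  · nlinarith [mul_nonneg (sq_nonneg x) (sub_nonneg.2 h.le)]

/-- `|x² d| ≤ 2(1 + x³)` for `x ≥ 0`, `|d| ≤ 2`. [folklore] -/
theorem abs_sq_mul_le {x d : ℝ} (hx : 0 ≤ x) (hd : |d| ≤ 2) : |x ^ 2 * d| ≤ 2 * (1 + x ^ 3) := by
  rw [abs_mul, abs_pow, abs_of_nonneg hx]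
  have h2 := sq_le_one_add_pow_three hx
  calc x ^ 2 * |d| ≤ x ^ 2 * 2 := by gcongr
    _ ≤ 2 * (1 + x ^ 3) := by linarith

/-- The weight term `[hit] (1 + x³)` is nonnegative. [folklore] -/
theorem termW_nonneg {p : Prop} {ip : Decidable p} {x : ℝ} (hx : 0 ≤ x) :
    0 ≤ @ite _ p ip (1 + x ^ 3) 0 := by
  split_ifs <;> positivity

/-- The isolated-capped term is dominated by twice the weight term. [folklore] -/
theorem termA_le_W {p q r : Prop} {ip ip' : Decidable p} {iq : Decidable q} {ir : Decidable r}
    {x d : ℝ} (hx : 0 ≤ x) (hd : |d| ≤ 2) :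
    |@ite _ p ip (@ite _ q iq 0 (@ite _ r ir 0 (x ^ 2 * d))) 0| ≤ 2 * @ite _ p ip' (1 + x ^ 3) 0 := by
  by_cases hp : p
  · simp only [if_pos hp]
    by_cases hq : q
    · simp only [if_pos hq, abs_zero]; positivity
    · simp only [if_neg hq]
      by_cases hr : r
      · simp only [if_pos hr, abs_zero]; positivity
      · simp only [if_neg hr]; exact abs_sq_mul_le hx hd
  · simp only [if_neg hp, abs_zero, mul_zero, le_refl]

/-- The near-capped term is dominated by twice the weight term. [folklore] -/
theorem termB_le_W {p q r : Prop} {ip ip' : Decidable p} {iq : Decidable q} {ir : Decidable r}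
    {x d : ℝ} (hx : 0 ≤ x) (hd : |d| ≤ 2) :
    |@ite _ p ip (@ite _ q iq (@ite _ r ir 0 (x ^ 2 * d)) 0) 0| ≤ 2 * @ite _ p ip' (1 + x ^ 3) 0 := by
  by_cases hp : p
  · simp only [if_pos hp]
    by_cases hq : q
    · simp only [if_pos hq]
      by_cases hr : r
      · simp only [if_pos hr, abs_zero]; positivity
      · simp only [if_neg hr]; exact abs_sq_mul_le hx hd
    · simp only [if_neg hq, abs_zero]; positivity
  · simp only [if_neg hp, abs_zero, mul_zero, le_refl]

/-- The fast term is dominated by `2/V` times the weight term. [folklore] -/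
theorem termR_le_W {p r : Prop} {ip ip' : Decidable p} {ir : Decidable r} {x d V : ℝ} (hV : 0 < V)
    (hx : 0 ≤ x) (hd : |d| ≤ 2) (hr : r → V < x) :
    |@ite _ p ip (@ite _ r ir (x ^ 2 * d) 0) 0| ≤ 2 / V * @ite _ p ip' (1 + x ^ 3) 0 := by
  by_cases hp : p
  · simp only [if_pos hp]
    by_cases hr' : r
    · simp only [if_pos hr']
      have hVx := hr hr'
      rw [abs_mul, abs_pow, abs_of_nonneg hx]
      calc x ^ 2 * |d| ≤ x ^ 2 * 2 := by gcongr
        _ ≤ 2 / V * (1 + x ^ 3) := by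
            rw [div_mul_eq_mul_div, le_div_iff₀ hV]
            nlinarith [sq_nonneg x, hVx.le, mul_nonneg (sq_nonneg x) (sub_nonneg.2 hVx.le)]
    · simp only [if_neg hr', abs_zero]; positivity
  · simp only [if_neg hp, abs_zero, mul_zero, le_refl]

/-- `|ψ(n₀) − ∫ ψ(f ξ) γ(dξ)| ≤ 2` for `|ψ| ≤ 1` and a probability measure `γ` (the `κ_g`-centred mark is
bounded by `2`; the Bochner integral of a non-integrable function is `0`, also fine). [folklore] -/
theorem abs_sub_avg_le_two {β : Type*} [MeasurableSpace β] (γ : Measure β) [IsProbabilityMeasure γ]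
    (φ : ℝ → T3 → V3 → V3 → V3 → ℝ) (hφ : ∀ s x v w n, |φ s x v w n| ≤ 1) (s : ℝ) (x : T3)
    (v w n₀ : V3) (f : β → V3) : |φ s x v w n₀ - ∫ ξ, φ s x v w (f ξ) ∂γ| ≤ 2 := by
  have h1 : |∫ ξ, φ s x v w (f ξ) ∂γ| ≤ 1 := by
    have := norm_integral_le_of_norm_le_const (μ := γ) (f := fun ξ => φ s x v w (f ξ)) (C := 1)
      (Eventually.of_forall fun ξ => by simpa only [Real.norm_eq_abs] using hφ s x v w (f ξ))
    simpa only [Real.norm_eq_abs, probReal_univ, mul_one] using this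
  calc |φ s x v w n₀ - ∫ ξ, φ s x v w (f ξ) ∂γ| ≤ |φ s x v w n₀| + |∫ ξ, φ s x v w (f ξ) ∂γ| :=
        abs_sub _ _
    _ ≤ 1 + 1 := add_le_add (hφ s x v w n₀) h1
    _ = 2 := by norm_num

/-! ## Measurability of the marks (torus geometry, `N + 1` spheres) -/

section MarkMeasurability

variable {N : ℕ}

/-- Position of sphere `i`, read on `ℝ × Config`. [folklore] -/
theorem measurable_pos₂ (i : Fin (N + 1)) :
    Measurable fun p : ℝ × Config (N + 1) (Fin 3) T3 => (p.2 i).1 :=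
  measurable_fst.comp ((measurable_pi_apply i).comp measurable_snd)

/-- Velocity of sphere `i`, read on `ℝ × Config`. [folklore] -/
theorem measurable_vel₂ (i : Fin (N + 1)) :
    Measurable fun p : ℝ × Config (N + 1) (Fin 3) T3 => (p.2 i).2 :=
  measurable_snd.comp ((measurable_pi_apply i).comp measurable_snd)

/-- Minimal-image separation of a pair, read on `ℝ × Config`. [folklore] -/
theorem measurable_sepVec₂ (i j : Fin (N + 1)) :
    Measurable fun p : ℝ × Config (N + 1) (Fin 3) T3 =>
      (Torus.geometry (Fin 3)).sepVec (p.2 i).1 (p.2 j).1 :=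
  Torus.isMeasurable_geometry.measurable_sepVec.comp ((measurable_pos₂ i).prodMk (measurable_pos₂ j))

/-- The contact midpoint `x_j + ½ sepVec(x_i, x_j)`, read on `ℝ × Config`, is measurable. [folklore] -/
theorem measurable_xmid₂ (i j : Fin (N + 1)) :
    Measurable fun p : ℝ × Config (N + 1) (Fin 3) T3 =>
      (Torus.geometry (Fin 3)).translate (p.2 j).1
        ((2 : ℝ)⁻¹ • (Torus.geometry (Fin 3)).sepVec (p.2 i).1 (p.2 j).1) :=
  Torus.isMeasurable_geometry.measurable_translate.comp
    ((measurable_pos₂ j).prodMk ((continuous_const_smul _).measurable.comp (measurable_sepVec₂ i j)))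

/-- The v4 near-field event "a third centre within `3e` of the contact midpoint of `(i, j)`" is measurable.
[folklore] -/
theorem measurableSet_nearBall (e : ℝ) (i j : Fin (N + 1)) :
    MeasurableSet {p : ℝ × Config (N + 1) (Fin 3) T3 | ∃ k : Fin (N + 1), k ≠ i ∧ k ≠ j ∧
      ‖(Torus.geometry (Fin 3)).sepVec (p.2 k).1
          ((Torus.geometry (Fin 3)).translate (p.2 j).1
            ((2 : ℝ)⁻¹ • (Torus.geometry (Fin 3)).sepVec (p.2 i).1 (p.2 j).1))‖ ≤ 3 * e} := by
  refine measurableSet_setOf.2 (Measurable.exists fun k => measurable_const.and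
    (measurable_const.and ?_))
  have h : Measurable fun p : ℝ × Config (N + 1) (Fin 3) T3 =>
      (Torus.geometry (Fin 3)).sepVec (p.2 k).1
        ((Torus.geometry (Fin 3)).translate (p.2 j).1
          ((2 : ℝ)⁻¹ • (Torus.geometry (Fin 3)).sepVec (p.2 i).1 (p.2 j).1)) :=
    Torus.isMeasurable_geometry.measurable_sepVec.comp ((measurable_pos₂ k).prodMk (measurable_xmid₂ i j))
  exact measurableSet_setOf.1 (measurableSet_le h.norm measurable_const)

/-- The Lambertian direction map `(ω, ξ) ↦ normalize(ω̂ + ξ̂)` is measurable. [folklore] -/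
theorem measurable_ldir₂ :
    Measurable fun q : V3 × V3 =>
      ‖‖q.1‖⁻¹ • q.1 + ‖q.2‖⁻¹ • q.2‖⁻¹ • (‖q.1‖⁻¹ • q.1 + ‖q.2‖⁻¹ • q.2) := by
  have ha : Measurable fun q : V3 × V3 => ‖q.1‖⁻¹ • q.1 + ‖q.2‖⁻¹ • q.2 :=
    (measurable_fst.norm.inv.smul measurable_fst).add (measurable_snd.norm.inv.smul measurable_snd)
  exact ha.norm.inv.smul ha

variable {φ : ℝ → T3 → V3 → V3 → V3 → ℝ}

/-- The mark `ψ(s, x_mid, vᵢ, vⱼ, ε⁻¹(xᵢ − xⱼ))` is jointly measurable in `(s, y)`. [folklore] -/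
theorem measurable_markPsi
    (hφ : Measurable fun p : ℝ × T3 × V3 × V3 × V3 => φ p.1 p.2.1 p.2.2.1 p.2.2.2.1 p.2.2.2.2)
    (e : ℝ) (i j : Fin (N + 1)) :
    Measurable fun p : ℝ × Config (N + 1) (Fin 3) T3 =>
      φ p.1 ((Torus.geometry (Fin 3)).translate (p.2 j).1
          ((2 : ℝ)⁻¹ • (Torus.geometry (Fin 3)).sepVec (p.2 i).1 (p.2 j).1))
        (p.2 i).2 (p.2 j).2 (e⁻¹ • (Torus.geometry (Fin 3)).sepVec (p.2 i).1 (p.2 j).1) := by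
  have h2 : Measurable fun v : V3 => (2 : ℝ)⁻¹ • v := (continuous_const_smul _).measurable
  have he : Measurable fun v : V3 => e⁻¹ • v := (continuous_const_smul _).measurable
  have hx : Measurable fun p : ℝ × Config (N + 1) (Fin 3) T3 =>
      (Torus.geometry (Fin 3)).translate (p.2 j).1
        ((2 : ℝ)⁻¹ • (Torus.geometry (Fin 3)).sepVec (p.2 i).1 (p.2 j).1) :=
    Torus.isMeasurable_geometry.measurable_translate.comp
      ((measurable_pos₂ j).prodMk (h2.comp (measurable_sepVec₂ i j)))
  exact hφ.comp (measurable_fst.prodMk (hx.prodMk ((measurable_vel₂ i).prodMk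
    ((measurable_vel₂ j).prodMk (he.comp (measurable_sepVec₂ i j))))))

/-- The `κ_g`-average `∫ ψ(s, x_mid, vᵢ, vⱼ, normalize(−ĝ + ξ̂)) γ(dξ)` is jointly measurable in
`(s, y)` (a parametrised Bochner integral of a jointly measurable integrand). [folklore] -/
theorem measurable_markAvg
    (hφ : Measurable fun p : ℝ × T3 × V3 × V3 × V3 => φ p.1 p.2.1 p.2.2.1 p.2.2.2.1 p.2.2.2.2)
    (i j : Fin (N + 1)) :
    Measurable fun p : ℝ × Config (N + 1) (Fin 3) T3 =>
      ∫ ξ, φ p.1 ((Torus.geometry (Fin 3)).translate (p.2 j).1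
          ((2 : ℝ)⁻¹ • (Torus.geometry (Fin 3)).sepVec (p.2 i).1 (p.2 j).1))
        (p.2 i).2 (p.2 j).2
        (‖‖-((p.2 i).2 - (p.2 j).2)‖⁻¹ • (-((p.2 i).2 - (p.2 j).2)) + ‖ξ‖⁻¹ • ξ‖⁻¹ •
          (‖-((p.2 i).2 - (p.2 j).2)‖⁻¹ • (-((p.2 i).2 - (p.2 j).2)) + ‖ξ‖⁻¹ • ξ))
        ∂(stdGaussian V3) := by
  have h2 : Measurable fun v : V3 => (2 : ℝ)⁻¹ • v := (continuous_const_smul _).measurable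
  have hx : Measurable fun q : (ℝ × Config (N + 1) (Fin 3) T3) × V3 =>
      (Torus.geometry (Fin 3)).translate (q.1.2 j).1
        ((2 : ℝ)⁻¹ • (Torus.geometry (Fin 3)).sepVec (q.1.2 i).1 (q.1.2 j).1) :=
    (Torus.isMeasurable_geometry.measurable_translate.comp
      ((measurable_pos₂ j).prodMk (h2.comp (measurable_sepVec₂ i j)))).comp
      measurable_fst
  have hg : Measurable fun q : (ℝ × Config (N + 1) (Fin 3) T3) × V3 =>
      -((q.1.2 i).2 - (q.1.2 j).2) :=
    (((measurable_vel₂ i).comp measurable_fst).sub ((measurable_vel₂ j).comp measurable_fst)).neg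
  have hL : Measurable fun q : (ℝ × Config (N + 1) (Fin 3) T3) × V3 =>
      ‖‖-((q.1.2 i).2 - (q.1.2 j).2)‖⁻¹ • (-((q.1.2 i).2 - (q.1.2 j).2)) + ‖q.2‖⁻¹ • q.2‖⁻¹ •
        (‖-((q.1.2 i).2 - (q.1.2 j).2)‖⁻¹ • (-((q.1.2 i).2 - (q.1.2 j).2)) + ‖q.2‖⁻¹ • q.2) := by
    -- elaborated WITHOUT expected type, then matched: the direct form sends the unifier astray
    have h := measurable_ldir₂.comp (hg.prodMk measurable_snd)
    exact h
  have hF : Measurable (Function.uncurry fun (p : ℝ × Config (N + 1) (Fin 3) T3) (ξ : V3) =>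
      φ p.1 ((Torus.geometry (Fin 3)).translate (p.2 j).1
          ((2 : ℝ)⁻¹ • (Torus.geometry (Fin 3)).sepVec (p.2 i).1 (p.2 j).1))
        (p.2 i).2 (p.2 j).2
        (‖‖-((p.2 i).2 - (p.2 j).2)‖⁻¹ • (-((p.2 i).2 - (p.2 j).2)) + ‖ξ‖⁻¹ • ξ‖⁻¹ •
          (‖-((p.2 i).2 - (p.2 j).2)‖⁻¹ • (-((p.2 i).2 - (p.2 j).2)) + ‖ξ‖⁻¹ • ξ))) :=
    hφ.comp ((measurable_fst.comp measurable_fst).prodMk (hx.prodMk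
      (((measurable_vel₂ i).comp measurable_fst).prodMk
        (((measurable_vel₂ j).comp measurable_fst).prodMk hL))))
  exact (hF.stronglyMeasurable.integral_prod_right (ν := stdGaussian V3)).measurable

end MarkMeasurability

/-! ## v6 (lead c3): registered sub-goals of the DISCHARGE of `HardSphereCampbellFormula` (Literature side) -/

section CampbellDischarge

open scoped NNReal

variable {d : Type*} [Fintype d] {N : ℕ} {ε : ℝ}

/-! ## W1 Flux statics -/

/-- STUB W1a: the pair term of the outgoing flux is symmetric under exchanging the roles of the two
particles of the pair. -/
theorem pairFlux_swap (hε0 : 0 ≤ ε) (hε : ε < 1 / 2) {a b : Fin N} (hab : a ≠ b)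
    {K : Config N d (UnitAddTorus d) → ℝ≥0∞} (hK : Measurable K) :
    ∫⁻ z : Config N d (UnitAddTorus d), ∫⁻ ω : Metric.sphere (0 : EuclideanSpace ℝ d) 1,
        ENNReal.ofReal (ε ^ (Fintype.card d - 1) * ⟪((ω : EuclideanSpace ℝ d)), (z a).2 - (z b).2⟫) *
          (hardSphereDomain (Torus.geometry d) N ε).indicator K (contactInsert ε a b (ω : EuclideanSpace ℝ d) z)
        ∂(volume : Measure (EuclideanSpace ℝ d)).toSphere =
      ∫⁻ z : Config N d (UnitAddTorus d), ∫⁻ ω : Metric.sphere (0 : EuclideanSpace ℝ d) 1,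
        ENNReal.ofReal (ε ^ (Fintype.card d - 1) * ⟪((ω : EuclideanSpace ℝ d)), (z b).2 - (z a).2⟫) *
          (hardSphereDomain (Torus.geometry d) N ε).indicator K (contactInsert ε b a (ω : EuclideanSpace ℝ d) z)
        ∂(volume : Measure (EuclideanSpace ℝ d)).toSphere :=
  Literature.MathematicalPhysics.KineticTheory.pairFlux_swap hε0 hε hab hK

/-- STUB W1b: the pair flux of an energy shell is finite. -/
theorem pairFlux_shell_lt_top (ε : ℝ) (a b : Fin N) (E₀ : ℝ) (c : ℝ≥0) :
    ∫⁻ z : Config N d (UnitAddTorus d), ∫⁻ ω : Metric.sphere (0 : EuclideanSpace ℝ d) 1,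
        ENNReal.ofReal (ε ^ (Fintype.card d - 1) * ⟪((ω : EuclideanSpace ℝ d)), (z a).2 - (z b).2⟫) *
          (hardSphereDomain (Torus.geometry d) N ε).indicator
            (fun w => if configEnergy w ≤ E₀ then (c : ℝ≥0∞) else 0)
            (contactInsert ε a b (ω : EuclideanSpace ℝ d) z)
        ∂(volume : Measure (EuclideanSpace ℝ d)).toSphere < ⊤ :=
  Literature.MathematicalPhysics.KineticTheory.pairFlux_shell_lt_top ε a b E₀ c

/-! ## W2 Flux null set -/

/-- STUB W2: in the contact configuration of the pair `(a, b)`, almost surely no OTHER pair is at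
distance exactly `ε`. -/
theorem pairFlux_otherContact_null (hε0 : 0 < ε) (hε : ε < 1 / 2) {a b : Fin N} (hab : a ≠ b) :
    ∫⁻ z : Config N d (UnitAddTorus d), ∫⁻ ω : Metric.sphere (0 : EuclideanSpace ℝ d) 1,
        {w : Config N d (UnitAddTorus d) | ∃ k l : Fin N, k ≠ l ∧ ({k, l} : Finset (Fin N)) ≠ {a, b} ∧
            ‖(Torus.geometry d).sepVec (w k).1 (w l).1‖ = ε}.indicator (fun _ => (1 : ℝ≥0∞))
          (contactInsert ε a b (ω : EuclideanSpace ℝ d) z)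
        ∂(volume : Measure (EuclideanSpace ℝ d)).toSphere = 0 :=
  Literature.MathematicalPhysics.KineticTheory.pairFlux_otherContact_null hε0 hε hab

/-! ## W3 ENGINE: the hit piece in pre-collision cylinder coordinates -/

/-- STUB W3a (ENGINE, special pair `(last, castAdd i)` of `s + 1 + 1` spheres). -/
theorem lintegral_hitPiece_eq_cylinder_last [Nonempty d] {s : ℕ} (i : Fin (s + 1)) {r δ V : ℝ} (hε : 0 < ε)
    (hch : ε + 2 * r < 2⁻¹) (hr : 2 * V * δ ≤ r) (hV : 0 ≤ V) (hδ : 0 ≤ δ)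
    {H : Config (s + 1 + 1) d (UnitAddTorus d) → ℝ≥0∞} (hH : Measurable H) :
    ∫⁻ u : Config (s + 1 + 1) d (UnitAddTorus d),
        (Alexander.hitPiece (s + 1 + 1) ε r δ (Fin.natAdd (s + 1) 0) (Fin.castAdd 1 i) ∩
            {u | configEnergy u ≤ V ^ 2 / 2}).indicator
          (fun u => H (collidePair (Torus.geometry d) (Fin.natAdd (s + 1) 0) (Fin.castAdd 1 i)
            (freeFlight (Torus.geometry d)
              (pairHitTime ε ((Torus.geometry d).sepVec (u (Fin.natAdd (s + 1) 0)).1 (u (Fin.castAdd 1 i)).1)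
                ((u (Fin.natAdd (s + 1) 0)).2 - (u (Fin.castAdd 1 i)).2)) u))) u =
      ∫⁻ z : Config (s + 1 + 1) d (UnitAddTorus d), ∫⁻ ω : Metric.sphere (0 : EuclideanSpace ℝ d) 1,
        ∫⁻ τ in Ioc (0 : ℝ) δ,
          ENNReal.ofReal (ε ^ (Fintype.card d - 1) *
              ⟪((ω : EuclideanSpace ℝ d)), (z (Fin.natAdd (s + 1) 0)).2 - (z (Fin.castAdd 1 i)).2⟫) *
            (Alexander.hitPiece (s + 1 + 1) ε r δ (Fin.natAdd (s + 1) 0) (Fin.castAdd 1 i) ∩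
                {u | configEnergy u ≤ V ^ 2 / 2}).indicator (fun _ => (1 : ℝ≥0∞))
              (freeFlight (Torus.geometry d) (-τ)
                (collidePair (Torus.geometry d) (Fin.natAdd (s + 1) 0) (Fin.castAdd 1 i)
                  (contactInsert ε (Fin.natAdd (s + 1) 0) (Fin.castAdd 1 i) (ω : EuclideanSpace ℝ d) z))) *
            H (contactInsert ε (Fin.natAdd (s + 1) 0) (Fin.castAdd 1 i) (ω : EuclideanSpace ℝ d) z)
        ∂volume ∂(volume : Measure (EuclideanSpace ℝ d)).toSphere :=
  Literature.MathematicalPhysics.KineticTheory.lintegral_hitPiece_eq_cylinder_last i hε hch hr hV hδ hH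

/-- STUB W3b-left (relabelling covariance of the hit-piece integral). -/
theorem lintegral_hitPiece_comp_perm (σ : Equiv.Perm (Fin N)) {r δ V : ℝ} (ε : ℝ)
    {a b : Fin N} (hab : a ≠ b)
    {H : Config N d (UnitAddTorus d) → ℝ≥0∞} (hH : Measurable H) :
    ∫⁻ u : Config N d (UnitAddTorus d),
        (Alexander.hitPiece N ε r δ a b ∩ {u | configEnergy u ≤ V ^ 2 / 2}).indicator
          (fun u => H (collidePair (Torus.geometry d) a b
            (freeFlight (Torus.geometry d)
              (pairHitTime ε ((Torus.geometry d).sepVec (u a).1 (u b).1) ((u a).2 - (u b).2)) u))) u =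
      ∫⁻ u : Config N d (UnitAddTorus d),
        (Alexander.hitPiece N ε r δ (σ a) (σ b) ∩ {u | configEnergy u ≤ V ^ 2 / 2}).indicator
          (fun u => H ((collidePair (Torus.geometry d) (σ a) (σ b)
            (freeFlight (Torus.geometry d)
              (pairHitTime ε ((Torus.geometry d).sepVec (u (σ a)).1 (u (σ b)).1) ((u (σ a)).2 - (u (σ b)).2))
                u)) ∘ σ)) u :=
  Literature.MathematicalPhysics.KineticTheory.lintegral_hitPiece_comp_perm σ ε hab hH

/-- STUB W3b-right (relabelling covariance of the cylinder-coordinate integral). -/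
theorem lintegral_hitPieceCylinder_comp_perm (σ : Equiv.Perm (Fin N)) {r δ V : ℝ} (ε : ℝ)
    {a b : Fin N} (hab : a ≠ b)
    {H : Config N d (UnitAddTorus d) → ℝ≥0∞} (hH : Measurable H) :
    ∫⁻ z : Config N d (UnitAddTorus d), ∫⁻ ω : Metric.sphere (0 : EuclideanSpace ℝ d) 1,
        ∫⁻ τ in Ioi (0 : ℝ),
          ENNReal.ofReal (ε ^ (Fintype.card d - 1) * ⟪((ω : EuclideanSpace ℝ d)), (z a).2 - (z b).2⟫) *
            (Alexander.hitPiece N ε r δ a b ∩ {u | configEnergy u ≤ V ^ 2 / 2}).indicator (fun _ => (1 : ℝ≥0∞))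
              (freeFlight (Torus.geometry d) (-τ)
                (collidePair (Torus.geometry d) a b (contactInsert ε a b (ω : EuclideanSpace ℝ d) z))) *
            H (contactInsert ε a b (ω : EuclideanSpace ℝ d) z)
        ∂volume ∂(volume : Measure (EuclideanSpace ℝ d)).toSphere =
      ∫⁻ z : Config N d (UnitAddTorus d), ∫⁻ ω : Metric.sphere (0 : EuclideanSpace ℝ d) 1,
        ∫⁻ τ in Ioi (0 : ℝ),
          ENNReal.ofReal (ε ^ (Fintype.card d - 1) * ⟪((ω : EuclideanSpace ℝ d)), (z (σ a)).2 - (z (σ b)).2⟫) *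
            (Alexander.hitPiece N ε r δ (σ a) (σ b) ∩ {u | configEnergy u ≤ V ^ 2 / 2}).indicator
                (fun _ => (1 : ℝ≥0∞))
              (freeFlight (Torus.geometry d) (-τ)
                (collidePair (Torus.geometry d) (σ a) (σ b)
                  (contactInsert ε (σ a) (σ b) (ω : EuclideanSpace ℝ d) z))) *
            H ((contactInsert ε (σ a) (σ b) (ω : EuclideanSpace ℝ d) z) ∘ σ)
        ∂volume ∂(volume : Measure (EuclideanSpace ℝ d)).toSphere :=
  Literature.MathematicalPhysics.KineticTheory.lintegral_hitPieceCylinder_comp_perm σ ε hab hH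

/-- STUB W3b-right-Ioc (relabelling covariance of the cylinder-coordinate integral over the window `(0, δ]`). -/
theorem lintegral_hitPieceCylinderIoc_comp_perm (σ : Equiv.Perm (Fin N)) {r δ V : ℝ} (ε : ℝ)
    {a b : Fin N} (hab : a ≠ b)
    {H : Config N d (UnitAddTorus d) → ℝ≥0∞} (hH : Measurable H) :
    ∫⁻ z : Config N d (UnitAddTorus d), ∫⁻ ω : Metric.sphere (0 : EuclideanSpace ℝ d) 1,
        ∫⁻ τ in Ioc (0 : ℝ) δ,
          ENNReal.ofReal (ε ^ (Fintype.card d - 1) * ⟪((ω : EuclideanSpace ℝ d)), (z a).2 - (z b).2⟫) *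
            (Alexander.hitPiece N ε r δ a b ∩ {u | configEnergy u ≤ V ^ 2 / 2}).indicator (fun _ => (1 : ℝ≥0∞))
              (freeFlight (Torus.geometry d) (-τ)
                (collidePair (Torus.geometry d) a b (contactInsert ε a b (ω : EuclideanSpace ℝ d) z))) *
            H (contactInsert ε a b (ω : EuclideanSpace ℝ d) z)
        ∂volume ∂(volume : Measure (EuclideanSpace ℝ d)).toSphere =
      ∫⁻ z : Config N d (UnitAddTorus d), ∫⁻ ω : Metric.sphere (0 : EuclideanSpace ℝ d) 1,
        ∫⁻ τ in Ioc (0 : ℝ) δ,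
          ENNReal.ofReal (ε ^ (Fintype.card d - 1) * ⟪((ω : EuclideanSpace ℝ d)), (z (σ a)).2 - (z (σ b)).2⟫) *
            (Alexander.hitPiece N ε r δ (σ a) (σ b) ∩ {u | configEnergy u ≤ V ^ 2 / 2}).indicator
                (fun _ => (1 : ℝ≥0∞))
              (freeFlight (Torus.geometry d) (-τ)
                (collidePair (Torus.geometry d) (σ a) (σ b)
                  (contactInsert ε (σ a) (σ b) (ω : EuclideanSpace ℝ d) z))) *
            H ((contactInsert ε (σ a) (σ b) (ω : EuclideanSpace ℝ d) z) ∘ σ)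
        ∂volume ∂(volume : Measure (EuclideanSpace ℝ d)).toSphere :=
  Literature.MathematicalPhysics.KineticTheory.lintegral_hitPieceCylinderIoc_comp_perm σ ε hab hH

/-- LEAD (from W3a + W3b): the ENGINE for a general pair. -/
theorem lintegral_hitPiece_eq_cylinder {r δ V : ℝ} (hε : 0 < ε) (hch : ε + 2 * r < 2⁻¹)
    (hr : 2 * V * δ ≤ r) (hV : 0 ≤ V) (hδ : 0 ≤ δ) {a b : Fin N} (hab : a ≠ b)
    {H : Config N d (UnitAddTorus d) → ℝ≥0∞} (hH : Measurable H) :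
    ∫⁻ u : Config N d (UnitAddTorus d),
        (Alexander.hitPiece N ε r δ a b ∩ {u | configEnergy u ≤ V ^ 2 / 2}).indicator
          (fun u => H (collidePair (Torus.geometry d) a b
            (freeFlight (Torus.geometry d)
              (pairHitTime ε ((Torus.geometry d).sepVec (u a).1 (u b).1) ((u a).2 - (u b).2)) u))) u =
      ∫⁻ z : Config N d (UnitAddTorus d), ∫⁻ ω : Metric.sphere (0 : EuclideanSpace ℝ d) 1,
        ∫⁻ τ in Ioc (0 : ℝ) δ,
          ENNReal.ofReal (ε ^ (Fintype.card d - 1) * ⟪((ω : EuclideanSpace ℝ d)), (z a).2 - (z b).2⟫) *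
            (Alexander.hitPiece N ε r δ a b ∩ {u | configEnergy u ≤ V ^ 2 / 2}).indicator (fun _ => (1 : ℝ≥0∞))
              (freeFlight (Torus.geometry d) (-τ)
                (collidePair (Torus.geometry d) a b (contactInsert ε a b (ω : EuclideanSpace ℝ d) z))) *
            H (contactInsert ε a b (ω : EuclideanSpace ℝ d) z)
        ∂volume ∂(volume : Measure (EuclideanSpace ℝ d)).toSphere :=
  Literature.MathematicalPhysics.KineticTheory.lintegral_hitPiece_eq_cylinder hε hch hr hV hδ hab hH

/-! ## W4 Hit-piece dynamics along a hard-sphere flow -/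

/-- STUB W4. -/
theorem collisionPairSum_ge_of_mem_hitPiece {r δ V : ℝ} (hε : 0 < ε) (hch : ε + 2 * r < 2⁻¹)
    (hr : 2 * V * δ ≤ r) (hV : 0 ≤ V) (hδ : 0 ≤ δ)
    (Φ : HardSphereFlow (Torus.geometry d) ε N) {a b : Fin N} (hab : a < b)
    {u : Config N d (UnitAddTorus d)} (hu : u ∈ Φ.good)
    (hmem : u ∈ Alexander.hitPiece N ε r δ a b) (hE : configEnergy u ≤ V ^ 2 / 2)
    (g : Config N d (UnitAddTorus d) → Fin N → Fin N → ℝ≥0∞) :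
    g (collidePair (Torus.geometry d) a b (freeFlight (Torus.geometry d)
        (pairHitTime ε ((Torus.geometry d).sepVec (u a).1 (u b).1) ((u a).2 - (u b).2)) u)) a b +
      g (collidePair (Torus.geometry d) a b (freeFlight (Torus.geometry d)
        (pairHitTime ε ((Torus.geometry d).sepVec (u a).1 (u b).1) ((u a).2 - (u b).2)) u)) b a ≤
      Φ.collisionPairSum (Ioc 0 δ) (fun _ w i j => g w i j) u :=
  Literature.MathematicalPhysics.KineticTheory.collisionPairSum_ge_of_mem_hitPiece hε hch hr hV hδ Φ hab hu hmem hE g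

/-! ## W5 Collision-sum bookkeeping on good orbits -/

/-- STUB W5a: window decomposition + stationarity, pathwise. -/
theorem collisionPairSum_windows (Φ : HardSphereFlow (Torus.geometry d) ε N)
    {z : Config N d (UnitAddTorus d)} (hz : z ∈ Φ.good) {δ : ℝ} (hδ : 0 ≤ δ) (m : ℕ)
    (g : Config N d (UnitAddTorus d) → Fin N → Fin N → ℝ≥0∞) :
    Φ.collisionPairSum (Ioc 0 (((m : ℝ) + 1) * δ)) (fun _ w i j => g w i j) z =
      ∑ w ∈ Finset.range (m + 1),
        Φ.collisionPairSum (Ioc 0 δ) (fun _ w i j => g w i j) (Φ.flow ((w : ℝ) * δ) z) :=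
  Literature.MathematicalPhysics.KineticTheory.collisionPairSum_windows Φ hz hδ m g

/-- STUB W5b: the collision pair sum of an energy-shell mark counts collisions twice. -/
theorem collisionPairSum_shellMark (hε' : ε < 2⁻¹) (Φ : HardSphereFlow (Torus.geometry d) ε N)
    {z : Config N d (UnitAddTorus d)} (hz : z ∈ Φ.good) (E₀ : ℝ) (c : ℝ≥0) (t : ℝ) :
    Φ.collisionPairSum (Ioc 0 t)
        (fun _ w (_ _ : Fin N) => if configEnergy w ≤ E₀ then (c : ℝ≥0∞) else 0) z =
      if configEnergy z ≤ E₀ then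
        2 * (c : ℝ≥0∞) * ((collisionTimes (Torus.geometry d) ε (fun s => Φ.flow s z) ∩ Ioc 0 t).ncard : ℝ≥0∞)
      else 0 :=
  Literature.MathematicalPhysics.KineticTheory.collisionPairSum_shellMark hε' Φ hz E₀ c t

/-! ## W6 Almost-everywhere measurability -/

/-- STUB W6 (AEM). -/
theorem aemeasurable_collisionPairSum (hε : 0 < ε) (hε' : ε < 1 / 2)
    (Φ : HardSphereFlow (Torus.geometry d) ε N)
    (g : Config N d (UnitAddTorus d) → Fin N → Fin N → ℝ≥0∞) (hg : ∀ i j, Measurable fun w => g w i j)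
    (τ : ℝ) :
    AEMeasurable (Φ.collisionPairSum (Ioc 0 τ) (fun _ w i j => g w i j))
      (liouville (Torus.geometry d) N ε) :=
  Literature.MathematicalPhysics.KineticTheory.aemeasurable_collisionPairSum hε hε' Φ g hg τ

/-! ## W7 The sharp collision-count bound from a one-window volume bound -/

/-- STUB W7. -/
theorem lintegral_ncard_collisionTimes_le_of_hitPiece_volume (hε : 0 < ε) (hε' : ε < 2⁻¹)
    (Φ : HardSphereFlow (Torus.geometry d) ε N) {V : ℝ} (hV : 0 ≤ V) {t : ℝ} (ht : 0 ≤ t) (F : ℝ≥0∞)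
    (hvol : ∀ δ : ℝ, 0 < δ → ε + 2 * (2 * V * δ) < 2⁻¹ →
      ∑ p : Fin N × Fin N, (if p.1 < p.2 then
        volume (Alexander.hitPiece N ε (2 * V * δ) δ p.1 p.2 ∩
          {u : Config N d (UnitAddTorus d) | configEnergy u ≤ V ^ 2 / 2}) else 0) ≤
        ENNReal.ofReal δ * F) :
    ∫⁻ z in {z | configEnergy z ≤ V ^ 2 / 2},
        ((collisionTimes (Torus.geometry d) ε (fun s => Φ.flow s z) ∩ Ioc 0 t).ncard : ℝ≥0∞)
          ∂(liouville (Torus.geometry d) N ε) ≤ ENNReal.ofReal t * F :=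
  Literature.MathematicalPhysics.KineticTheory.lintegral_ncard_collisionTimes_le_of_hitPiece_volume hε hε' Φ hV ht F hvol

/-! ## Assembly (lead) -/

/-- LEAD: the lower bound input `LB` of `hardSphereCampbellFormula_dim_of`. -/
theorem campbell_lowerBound (d : Type*) [Fintype d] (N : ℕ) (ε : ℝ) (hε : 0 < ε) (hε' : ε < 1 / 2)
    (Φ : HardSphereFlow (Torus.geometry d) ε N)
    (g : Config N d (UnitAddTorus d) → Fin N → Fin N → ℝ≥0∞) (hg : ∀ i j, Measurable fun w => g w i j)
    (τ : ℝ) (hτ : 0 < τ) :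
    ENNReal.ofReal τ * outgoingCollisionFlux ε N g ≤
      ∫⁻ z, Φ.collisionPairSum (Ioc 0 τ) (fun _ w i j => g w i j) z ∂(liouville (Torus.geometry d) N ε) :=
  Literature.MathematicalPhysics.KineticTheory.campbell_lowerBound d N ε hε hε' Φ g hg τ hτ

/-- LEAD: the upper bound input `UB` of `hardSphereCampbellFormula_dim_of`. -/
theorem campbell_upperBound (d : Type*) [Fintype d] (N : ℕ) (ε : ℝ) (hε : 0 < ε) (hε' : ε < 1 / 2)
    (Φ : HardSphereFlow (Torus.geometry d) ε N) (E₀ : ℝ) (c : ℝ≥0) (τ : ℝ) (hτ : 0 < τ) :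
    (∫⁻ z, Φ.collisionPairSum (Ioc 0 τ)
        (fun _ w _ _ => if configEnergy w ≤ E₀ then (c : ℝ≥0∞) else 0) z ∂(liouville (Torus.geometry d) N ε) ≤
      ENNReal.ofReal τ *
        outgoingCollisionFlux ε N (fun (w : Config N d (UnitAddTorus d)) _ _ =>
          if configEnergy w ≤ E₀ then (c : ℝ≥0∞) else 0)) ∧
    outgoingCollisionFlux ε N (fun (w : Config N d (UnitAddTorus d)) (_ _ : Fin N) =>
      if configEnergy w ≤ E₀ then (c : ℝ≥0∞) else 0) ≠ ⊤ :=
  Literature.MathematicalPhysics.KineticTheory.campbell_upperBound d N ε hε hε' Φ E₀ c τ hτ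

/-- **`HardSphereCampbellFormula` holds.** -/
theorem hardSphereCampbellFormula_holds' : HardSphereCampbellFormula :=
  Literature.MathematicalPhysics.KineticTheory.hardSphereCampbellFormula_holds

/-- LEAD (v6): the EQUILIBRIUM CRUX, unconditional — `stub_eqCrux` with the named fact discharged. -/
theorem eq_contactAngleEquidistribution_unconditional :
    let Cfg : ℕ → Type := fun N => Config (N + 1) (Fin 3) T3
    let G := Torus.geometry (Fin 3)
    let ε : ℝ → ℕ → ℝ := hsDiameter
    let τ : ℝ → (N : ℕ) → Cfg N → ℝ≥0∞ := fun σ N z => Alexander.freeExitTime G (ε σ N) z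
    let S : ℝ → (N : ℕ) → Cfg N → Cfg N := fun t _ z => freeFlight G t z
    let ldir : V3 → V3 → V3 := fun ω ξ => ‖‖ω‖⁻¹ • ω + ‖ξ‖⁻¹ • ξ‖⁻¹ • (‖ω‖⁻¹ • ω + ‖ξ‖⁻¹ • ξ)
    let zpre : ℝ → (N : ℕ) → Cfg N → ℕ → Cfg N := fun σ N z m =>
      let y := Alexander.stateAfter G (ε σ N) z m; S (τ σ N y).toReal N y
    let Kt : ℝ → (N : ℕ) → Cfg N → ℝ → ℕ := fun σ N z t => Alexander.collisionCount G (ε σ N) z t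
    let hit : ℝ → (N : ℕ) → Cfg N → Fin (N + 1) → Fin (N + 1) → Prop := fun σ N y i j =>
      i < j ∧ y ∈ contactSet G (N + 1) (ε σ N) i j ∧ IsIncoming G y i j
    let tcol : ℝ → (N : ℕ) → Cfg N → ℕ → ℝ := fun σ N z m =>
      (Alexander.collisionInstant G (ε σ N) z (m + 1)).toReal
    let xmid : (N : ℕ) → Cfg N → Fin (N + 1) → Fin (N + 1) → T3 := fun _ y i j =>
      G.translate (y j).1 ((2 : ℝ)⁻¹ • G.sepVec (y i).1 (y j).1)
    ∀ θ : ℝ, 0 < θ → ∃ σ₀ : ℝ, 0 < σ₀ ∧ ∀ σ : ℝ, 0 < σ → σ < σ₀ →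
      ∀ Φ : (N : ℕ) → HardSphereFlow G (ε σ N) (N + 1),
      let Q := fun N => localGibbsLaw σ (fun _ => 1) (fun _ => 0) (fun _ => θ) N (Φ N)
      ∀ t : ℝ, 0 ≤ t → ∀ ψ : ℕ → ℝ → T3 → V3 → V3 → V3 → ℝ,
        (∀ N, Measurable (fun p : ℝ × T3 × V3 × V3 × V3 =>
          ψ N p.1 p.2.1 p.2.2.1 p.2.2.2.1 p.2.2.2.2)) →
        (∀ N s x v w n, |ψ N s x v w n| ≤ 1) →
        Tendsto (fun N : ℕ => ∫ z, ((N : ℝ) + 1) ^ (-(4 / 3 : ℝ)) *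
          ∑ m ∈ Finset.range (Kt σ N z t), ∑ i : Fin (N + 1), ∑ j : Fin (N + 1),
            (let y := zpre σ N z m
             if hit σ N y i j then
               ‖(y i).2 - (y j).2‖ ^ 2 *
                 (ψ N (tcol σ N z m) (xmid N y i j) (y i).2 (y j).2 ((ε σ N)⁻¹ • G.sepVec (y i).1 (y j).1) -
                   ∫ ξ, ψ N (tcol σ N z m) (xmid N y i j) (y i).2 (y j).2 (ldir (-((y i).2 - (y j).2)) ξ)
                     ∂(stdGaussian V3))
             else 0) ∂(Q N)) atTop (𝓝 0) :=
  Summit.AtomisticToContinuum.HydrodynamicLimit.Theorems.ContactAngleEquidistributionSketch.stub_eqCrux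
    hardSphereCampbellFormula_holds'

end CampbellDischarge

/-! ## v7 (continuation lead c4, cycle 5): the crux for ALL CONSTANT PROFILES by Galilean covariance

The unconditional equilibrium theorem `eq_contactAngleEquidistribution_unconditional` (v6) is stated for the
rest-frame unit-activity Gibbs law `localGibbsLaw σ 1 0 θ`. Every CONSTANT profile `(a, u, θ)` (`a ≠ 0`, `θ > 0`,
`u ∈ ℝ³`: the drifting global equilibria of the torus gas) reduces to it by two exact symmetries: the activity is
decorative at fixed particle number (`KineticWindowGronwallNegative.localGibbsLaw_const_activity`), and the drift is
a Galilean boost — `(velShift u)_# G_N(a, 0, θ) = G_N(a, u, θ)` (`KineticWindowGronwallBoost.localGibbsLaw_const_map_velShift_zero`)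
while Alexander's collision-by-collision construction is boost-COVARIANT (new: `Boost.freeExitTime_boostAt`, …,
`Boost.collisionCount_boostAt`), so that the crux functional of `ψ` read on the boosted datum is the crux functional of
the boosted (again admissible) test function `ψ^u(s, x, v, w, n) = ψ(s, x + s u, v + u, w + u, n)` read on the datum.
-/

section Boost

open Summit.AtomisticToContinuum.HydrodynamicLimit.Theorems.KineticWindowGronwallBoost

variable {d : Type*} [Fintype d] {n : ℕ}

/- The REAL sum of the first `k` free exit times of Alexander's construction,
`exitSum z k := ∑_{m<k} (τ(z_m)).toReal` (written inline below; no definition is introduced) — the position shift per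
unit drift accumulated by a boosted datum after `k` collisions, equal to `(t_k).toReal` whenever `t_k < ∞`. -/

/-- STUB B1 (CLOSED — p131625): the free exit time is boost-invariant (free flight is boost-covariant,
`freeFlight_boostAt`, and the hard-sphere domain is boost-invariant). [folklore] -/
theorem freeExitTime_boostAt (ε : ℝ) (u : EuclideanSpace ℝ d) (s : ℝ) (z : Config n d (UnitAddTorus d)) :
    Alexander.freeExitTime (Torus.geometry d) ε (boostAt u s z) = Alexander.freeExitTime (Torus.geometry d) ε z :=
  -- LANDED (wave 1, v7): p131625 `Theorems/…BoostAlexander.lean`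
  Summit.AtomisticToContinuum.HydrodynamicLimit.Theorems.ContactAngleEquidistributionSketch.freeExitTime_boostAt ε u s z

/-- STUB B2 (CLOSED — p131625): the incoming contact pairs are boost-invariant. [folklore] -/
theorem incomingPairs_boostAt (ε : ℝ) (u : EuclideanSpace ℝ d) (s : ℝ) (z : Config n d (UnitAddTorus d)) :
    Alexander.incomingPairs (Torus.geometry d) ε (boostAt u s z) = Alexander.incomingPairs (Torus.geometry d) ε z :=
  -- LANDED (wave 1, v7): p131625
  Summit.AtomisticToContinuum.HydrodynamicLimit.Theorems.ContactAngleEquidistributionSketch.incomingPairs_boostAt ε u s z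

/-- STUB B3 (CLOSED — p131625): ONE COLLISION STEP IS BOOST-COVARIANT — the step of the boosted datum is the
boost, at the time advanced by the free exit time, of the step of the datum (`toReal ∞ = 0` makes the no-collision
case consistent). [folklore] -/
theorem collisionStep_boostAt (ε : ℝ) (u : EuclideanSpace ℝ d) (s : ℝ) (z : Config n d (UnitAddTorus d)) :
    Alexander.collisionStep (Torus.geometry d) ε (boostAt u s z) =
      boostAt u (s + (Alexander.freeExitTime (Torus.geometry d) ε z).toReal)
        (Alexander.collisionStep (Torus.geometry d) ε z) :=
  -- LANDED (wave 1, v7): p131625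
  Summit.AtomisticToContinuum.HydrodynamicLimit.Theorems.ContactAngleEquidistributionSketch.collisionStep_boostAt ε u s z

/-- STUB B4 (CLOSED — p131625): the post-collisional states are boost-covariant, the boost time advancing
by the accumulated real exit times `∑_{m<k} (τ(z_m)).toReal`. [folklore] -/
theorem stateAfter_boostAt (ε : ℝ) (u : EuclideanSpace ℝ d) (s : ℝ) (z : Config n d (UnitAddTorus d)) (k : ℕ) :
    Alexander.stateAfter (Torus.geometry d) ε (boostAt u s z) k =
      boostAt u (s + ∑ m ∈ Finset.range k,
          (Alexander.freeExitTime (Torus.geometry d) ε (Alexander.stateAfter (Torus.geometry d) ε z m)).toReal)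
        (Alexander.stateAfter (Torus.geometry d) ε z k) :=
  -- LANDED (wave 1, v7): p131625
  Summit.AtomisticToContinuum.HydrodynamicLimit.Theorems.ContactAngleEquidistributionSketch.stateAfter_boostAt ε u s z k

/-- STUB B5 (CLOSED — p131625): the collision instants are boost-invariant. [folklore] -/
theorem collisionInstant_boostAt (ε : ℝ) (u : EuclideanSpace ℝ d) (s : ℝ) (z : Config n d (UnitAddTorus d)) (k : ℕ) :
    Alexander.collisionInstant (Torus.geometry d) ε (boostAt u s z) k =
      Alexander.collisionInstant (Torus.geometry d) ε z k :=
  -- LANDED (wave 1, v7): p131625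
  Summit.AtomisticToContinuum.HydrodynamicLimit.Theorems.ContactAngleEquidistributionSketch.collisionInstant_boostAt ε u s z k

/-- STUB B6 (CLOSED — p131625): the collision count is boost-invariant. [folklore] -/
theorem collisionCount_boostAt (ε : ℝ) (u : EuclideanSpace ℝ d) (s : ℝ) (z : Config n d (UnitAddTorus d)) (t : ℝ) :
    Alexander.collisionCount (Torus.geometry d) ε (boostAt u s z) t =
      Alexander.collisionCount (Torus.geometry d) ε z t :=
  -- LANDED (wave 1, v7): p131625
  Summit.AtomisticToContinuum.HydrodynamicLimit.Theorems.ContactAngleEquidistributionSketch.collisionCount_boostAt ε u s z t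

/-- STUB B7 (CLOSED — p131696): a finite collision instant is the real sum of the exit times. [folklore] -/
theorem exitSum_eq_toReal_collisionInstant (ε : ℝ) {z : Config n d (UnitAddTorus d)} {k : ℕ}
    (h : Alexander.collisionInstant (Torus.geometry d) ε z k ≠ ∞) :
    ∑ m ∈ Finset.range k,
        (Alexander.freeExitTime (Torus.geometry d) ε (Alexander.stateAfter (Torus.geometry d) ε z m)).toReal =
      (Alexander.collisionInstant (Torus.geometry d) ε z k).toReal :=
  -- LANDED (wave 1, v7): p131696 `Theorems/…BoostInstants.lean`
  Summit.AtomisticToContinuum.HydrodynamicLimit.Theorems.ContactAngleEquidistributionSketch.exitSum_eq_toReal_collisionInstant ε h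

/-- STUB B8 (CLOSED — p131696): every counted collision happens at a finite instant `≤ t` — for
`m < collisionCount z t` (no goodness assumption: a Zeno orbit has the junk count `0`). [folklore] -/
theorem collisionInstant_succ_le_of_mem_range (ε : ℝ) {z : Config n d (UnitAddTorus d)} {t : ℝ} {m : ℕ}
    (hm : m ∈ Finset.range (Alexander.collisionCount (Torus.geometry d) ε z t)) :
    Alexander.collisionInstant (Torus.geometry d) ε z (m + 1) ≤ ENNReal.ofReal t :=
  -- LANDED (wave 1, v7): p131696
  Summit.AtomisticToContinuum.HydrodynamicLimit.Theorems.ContactAngleEquidistributionSketch.collisionInstant_succ_le_of_mem_range ε hm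

/-- STUB B9 (CLOSED — p131850): THE LOCAL GIBBS LAW UNDER A VELOCITY TRANSLATION, GENERAL PROFILES —
`(velShift u)_# LG_N(a₀, u₀, θ₀) = LG_N(a₀, u₀ + u, θ₀)` for ALL profiles (no sign / positivity hypothesis: the
one-particle profile transforms pointwise, `a₀(x) M_{θ₀(x), u₀(x)}(v - u) = a₀(x) M_{θ₀(x), u₀(x) + u}(v)`, the
canonical partition functions agree by the volume-preserving change of variables `velShift u`, and the Liouville
measure is `velShift`-invariant; the type-fixing flows `Φ, Ψ` are arbitrary). The constant-profile case is the tree's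
`KineticWindowGronwallBoost.localGibbsLaw_const_map_velShift`. [folklore] -/
theorem localGibbsLaw_map_velShift (σ : ℝ) (a₀ θ₀ : T3 → ℝ) (u₀ : T3 → V3) (u : V3) (N : ℕ)
    (Φ Ψ : HardSphereFlow (Torus.geometry (Fin 3)) (hsDiameter σ N) (N + 1)) :
    (localGibbsLaw σ a₀ u₀ θ₀ N Φ).map (velShift u) = localGibbsLaw σ a₀ (fun x => u₀ x + u) θ₀ N Ψ :=
  -- LANDED (wave 1, v7): p131850 `Theorems/…BoostGibbs.lean`
  Summit.AtomisticToContinuum.HydrodynamicLimit.Theorems.ContactAngleEquidistributionSketch.localGibbsLaw_map_velShift σ a₀ θ₀ u₀ u N Φ Ψ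

/-- `velShift u` is the boost at time `0`. [folklore] -/
theorem velShift_eq_boostAt (u : V3) (z : Config n (Fin 3) T3) : velShift u z = boostAt u 0 z :=
  Summit.AtomisticToContinuum.HydrodynamicLimit.Theorems.ContactAngleEquidistributionSketch.velShift_eq_boostAt u z

/-- STUB L1 (LEAD, v7; CLOSED — landed as `cruxFunctional_velShift`, p132123): COVARIANCE OF THE CRUX FUNCTIONAL — the crux functional of `ψ` read on the velocity-translated
datum `velShift u z` is the crux functional, read on `z`, of the boosted test function
`ψ^u(s, x, v, w, n) = ψ(s, x + s u, v + u, w + u, n)`. -/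
theorem stub_cruxFunctionalVelShift :
    let Cfg : ℕ → Type := fun N => Config (N + 1) (Fin 3) T3
    let G := Torus.geometry (Fin 3)
    let ε : ℝ → ℕ → ℝ := hsDiameter
    let τ : ℝ → (N : ℕ) → Cfg N → ℝ≥0∞ := fun σ N z => Alexander.freeExitTime G (ε σ N) z
    let S : ℝ → (N : ℕ) → Cfg N → Cfg N := fun t _ z => freeFlight G t z
    let ldir : V3 → V3 → V3 := fun ω ξ => ‖‖ω‖⁻¹ • ω + ‖ξ‖⁻¹ • ξ‖⁻¹ • (‖ω‖⁻¹ • ω + ‖ξ‖⁻¹ • ξ)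
    let zpre : ℝ → (N : ℕ) → Cfg N → ℕ → Cfg N := fun σ N z m =>
      let y := Alexander.stateAfter G (ε σ N) z m; S (τ σ N y).toReal N y
    let Kt : ℝ → (N : ℕ) → Cfg N → ℝ → ℕ := fun σ N z t => Alexander.collisionCount G (ε σ N) z t
    let hit : ℝ → (N : ℕ) → Cfg N → Fin (N + 1) → Fin (N + 1) → Prop := fun σ N y i j =>
      i < j ∧ y ∈ contactSet G (N + 1) (ε σ N) i j ∧ IsIncoming G y i j
    let tcol : ℝ → (N : ℕ) → Cfg N → ℕ → ℝ := fun σ N z m =>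
      (Alexander.collisionInstant G (ε σ N) z (m + 1)).toReal
    let xmid : (N : ℕ) → Cfg N → Fin (N + 1) → Fin (N + 1) → T3 := fun _ y i j =>
      G.translate (y j).1 ((2 : ℝ)⁻¹ • G.sepVec (y i).1 (y j).1)
    let D : (ℕ → ℝ → T3 → V3 → V3 → V3 → ℝ) → ℝ → (N : ℕ) → ℝ → Cfg N → ℝ := fun ψ σ N t z =>
      ((N : ℝ) + 1) ^ (-(4 / 3 : ℝ)) *
        ∑ m ∈ Finset.range (Kt σ N z t), ∑ i : Fin (N + 1), ∑ j : Fin (N + 1),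
          (let y := zpre σ N z m
           if hit σ N y i j then
             ‖(y i).2 - (y j).2‖ ^ 2 *
               (ψ N (tcol σ N z m) (xmid N y i j) (y i).2 (y j).2 ((ε σ N)⁻¹ • G.sepVec (y i).1 (y j).1) -
                 ∫ ξ, ψ N (tcol σ N z m) (xmid N y i j) (y i).2 (y j).2 (ldir (-((y i).2 - (y j).2)) ξ)
                   ∂(stdGaussian V3))
           else 0)
    ∀ (ψ : ℕ → ℝ → T3 → V3 → V3 → V3 → ℝ) (u : V3) (σ : ℝ) (N : ℕ) (t : ℝ) (z : Cfg N),
      D ψ σ N t (velShift u z) =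
        D (fun N s x v w n => ψ N s (x + Literature.Analysis.FunctionSpaces.Torus.proj (s • u)) (v + u) (w + u) n)
          σ N t z :=
  -- LANDED (lead, v7): p132123 `Theorems/…BoostFunctional.lean`
  Summit.AtomisticToContinuum.HydrodynamicLimit.Theorems.ContactAngleEquidistributionSketch.cruxFunctional_velShift

/-- STUB L2 (LEAD, v7; CLOSED — landed as `eq_contactAngleEquidistribution_const`, p132196): **THE CRUX FOR EVERY CONSTANT PROFILE** — for all `a ≠ 0`, `θ > 0`, `u ∈ ℝ³` there is `σ₀ > 0`
(depending on `θ` only) such that for `0 < σ < σ₀`, every family `Φ`, every `t ≥ 0` and every admissible `ψ_N`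
(jointly measurable, `|ψ_N| ≤ 1`), the mean under the drifting global Gibbs law `localGibbsLaw σ a u θ N (Φ N)` of
the crux functional — VERBATIM the body of `ContactAngleEquidistribution` — tends to `0`. -/
theorem stub_eqConst :
    let Cfg : ℕ → Type := fun N => Config (N + 1) (Fin 3) T3
    let G := Torus.geometry (Fin 3)
    let ε : ℝ → ℕ → ℝ := hsDiameter
    let τ : ℝ → (N : ℕ) → Cfg N → ℝ≥0∞ := fun σ N z => Alexander.freeExitTime G (ε σ N) z
    let S : ℝ → (N : ℕ) → Cfg N → Cfg N := fun t _ z => freeFlight G t z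
    let ldir : V3 → V3 → V3 := fun ω ξ => ‖‖ω‖⁻¹ • ω + ‖ξ‖⁻¹ • ξ‖⁻¹ • (‖ω‖⁻¹ • ω + ‖ξ‖⁻¹ • ξ)
    let zpre : ℝ → (N : ℕ) → Cfg N → ℕ → Cfg N := fun σ N z m =>
      let y := Alexander.stateAfter G (ε σ N) z m; S (τ σ N y).toReal N y
    let Kt : ℝ → (N : ℕ) → Cfg N → ℝ → ℕ := fun σ N z t => Alexander.collisionCount G (ε σ N) z t
    let hit : ℝ → (N : ℕ) → Cfg N → Fin (N + 1) → Fin (N + 1) → Prop := fun σ N y i j =>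
      i < j ∧ y ∈ contactSet G (N + 1) (ε σ N) i j ∧ IsIncoming G y i j
    let tcol : ℝ → (N : ℕ) → Cfg N → ℕ → ℝ := fun σ N z m =>
      (Alexander.collisionInstant G (ε σ N) z (m + 1)).toReal
    let xmid : (N : ℕ) → Cfg N → Fin (N + 1) → Fin (N + 1) → T3 := fun _ y i j =>
      G.translate (y j).1 ((2 : ℝ)⁻¹ • G.sepVec (y i).1 (y j).1)
    ∀ (a θ : ℝ) (u : V3), a ≠ 0 → 0 < θ → ∃ σ₀ : ℝ, 0 < σ₀ ∧ ∀ σ : ℝ, 0 < σ → σ < σ₀ →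
      ∀ Φ : (N : ℕ) → HardSphereFlow G (ε σ N) (N + 1),
      let Q := fun N => localGibbsLaw σ (fun _ => a) (fun _ => u) (fun _ => θ) N (Φ N)
      ∀ t : ℝ, 0 ≤ t → ∀ ψ : ℕ → ℝ → T3 → V3 → V3 → V3 → ℝ,
        (∀ N, Measurable (fun p : ℝ × T3 × V3 × V3 × V3 =>
          ψ N p.1 p.2.1 p.2.2.1 p.2.2.2.1 p.2.2.2.2)) →
        (∀ N s x v w n, |ψ N s x v w n| ≤ 1) →
        Tendsto (fun N : ℕ => ∫ z, ((N : ℝ) + 1) ^ (-(4 / 3 : ℝ)) *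
          ∑ m ∈ Finset.range (Kt σ N z t), ∑ i : Fin (N + 1), ∑ j : Fin (N + 1),
            (let y := zpre σ N z m
             if hit σ N y i j then
               ‖(y i).2 - (y j).2‖ ^ 2 *
                 (ψ N (tcol σ N z m) (xmid N y i j) (y i).2 (y j).2 ((ε σ N)⁻¹ • G.sepVec (y i).1 (y j).1) -
                   ∫ ξ, ψ N (tcol σ N z m) (xmid N y i j) (y i).2 (y j).2 (ldir (-((y i).2 - (y j).2)) ξ)
                     ∂(stdGaussian V3))
             else 0) ∂(Q N)) atTop (𝓝 0) :=
  -- LANDED (lead, v7): p132196 `Theorems/…EqConst.lean`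
  Summit.AtomisticToContinuum.HydrodynamicLimit.Theorems.ContactAngleEquidistributionSketch.eq_contactAngleEquidistribution_const

end Boost

/-! ## v8 (continuation lead c5, 2026-08-17): the COLLISION SUM RULE layer — the first unconditional
NON-equilibrium statements about the crux's collision sums, and a certified necessary condition

Velocities change only at collisions, by the elastic reflection of the colliding pair; hence for every
velocity observable `φ` the collision sum of the collisional changes
`Δφ = φ(vᵢ') + φ(vⱼ') − φ(vᵢ) − φ(vⱼ)` over Alexander's construction TELESCOPES pathwise to
`Σᵢ φ(vᵢ(after K collisions)) − Σᵢ φ(vᵢ(0))` (`stub_velTelescope`, forward-good data — a.e. under every local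
Gibbs law). With `|φ(v)| ≤ c(1 + |v|²)`, energy conservation and the second velocity moment of the local Gibbs
law (`exists_lintegral_sum_norm_sq_localGibbsLaw_le`) this gives the COLLISION SUM RULE (`stub_sumRule`, lead):
for EVERY family of continuous profiles, every `0 < σ < 1/2`, `Φ`, `t`:
`|E_{P_N} (N+1)^{-4/3} Σ_{coll ≤ t} Δφ_N| ≤ C (N+1)^{-1/3}` — no equilibrium, no chaos, no named fact.
For a quadratic observable `q_T(v) = ⟪v, T v⟫` (`‖T‖ ≤ 1`) the collisional change is a function of the
incoming velocities and the unit contact normal, `Dq_T(v, w, ω) = q(v − ⟪g,ω⟫ω) + q(w + ⟪g,ω⟫ω) − q(v) − q(w)`,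
`|Dq_T| ≤ 4|g|²`, `12|g|²`-Lipschitz in `ω ∈ S²`; so `ψ_T := Dq_T(v, w, n̂)/(12|g|²)` is an ADMISSIBLE mark of the
crux (`stub_psiT_measurable`, `stub_psiT_bound`, `stub_psiT_lipschitz`) reading `Δq_T/ (12|g|²)` on every hit
(`stub_psiT_hit`). Feeding `ψ_T` to the crux and subtracting the sum rule: the crux FORCES
`(N+1)^{-4/3} E_{P_N} Σ_{coll ≤ t} K_{T_N}(vᵢ, vⱼ) → 0`, `K_T(v, w) := ∫ Dq_T(v, w, normalize(−ĝ + ξ̂)) γ(dξ)` the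
`κ_g`-mean of the collisional change (`stub_velocityIsotropy`, lead). On paper `K_T = (1/6)(|g|² tr T − 3⟪g, T g⟫)`
(cosine law: `E[cos²θ sin²θ] = 1/6`), so for traceless `T` this is `−½ (N+1)^{-4/3} E Σ_coll ⟪g, T g⟫ → 0`: the
`N^{4/3}`-normalised second-moment tensor of the collision relative velocities is asymptotically ISOTROPIC
— the crux contains a local-Maxwellian-in-collision-average statement for the deterministic dense gas
(ideator notes F1/F7), i.e. an H-theorem-type relaxation input (`BoltzmannHypothesisBarrier`, `DiluteRegimeBarrier`). -/

section SumRule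

/-- STUB (v8) `velTelescope` — pathwise velocity telescoping along Alexander's construction: on a forward-good datum
whose first `K` free flights are finite, the change of `Σᵢ φ(vᵢ)` over the first `K` collisions is the sum over
`m < K` of the `hit`-selected collisional changes read on the pre-collisional exit configurations `y_m`
(`Alexander.FwdGood.exists_stateAfter_succ`: `z_{m+1} = collidePair p y_m` for the unique incoming contact pair
`p` of `y_m`; `sum_sum_ite_hit_eq`; free flight keeps velocities; `collidePair` changes only the pair). [folklore] -/
theorem stub_velTelescope {d : Type*} [Fintype d] {X : Type*} {n : ℕ} (G : Geometry d X) (ε : ℝ)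
    {M : Type*} [AddCommGroup M] (φ : EuclideanSpace ℝ d → M) {z : Config n d X}
    (hz : Alexander.FwdGood G ε z) {K : ℕ}
    (hK : ∀ m < K, Alexander.freeExitTime G ε (Alexander.stateAfter G ε z m) ≠ ∞) :
    ∑ i, φ ((Alexander.stateAfter G ε z K i).2) - ∑ i, φ ((z i).2) =
      ∑ m ∈ Finset.range K, ∑ i : Fin n, ∑ j : Fin n,
        (let y := freeFlight G (Alexander.freeExitTime G ε (Alexander.stateAfter G ε z m)).toReal
            (Alexander.stateAfter G ε z m)
         if i < j ∧ y ∈ contactSet G n ε i j ∧ IsIncoming G y i j then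
           φ ((collidePair G i j y i).2) + φ ((collidePair G i j y j).2) - φ ((y i).2) - φ ((y j).2)
         else 0) :=
  -- LANDED (p134025)
  Summit.AtomisticToContinuum.HydrodynamicLimit.Theorems.ContactAngleEquidistributionSketch.stub_velTelescope G ε φ hz hK

/-- STUB (v8, lead) `sumRule` — the COLLISION SUM RULE under every local Gibbs law: for continuous profiles,
`0 < σ < 1/2`, every `Φ`, `t`, and velocity observables `φ_N` with `|φ_N(v)| ≤ c(1 + |v|²)`, the normalised
collision sum of the collisional changes has `|E_{P_N}[(N+1)^{-4/3} Σ_{coll ≤ t} Δφ_N]| ≤ C (N+1)^{-1/3}`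
(`stub_velTelescope` a.e. — `ae_mem_good_localGibbsLaw` —, energy conservation `configEnergy_stateAfter`,
`exists_lintegral_sum_norm_sq_localGibbsLaw_le`, `norm_integral_le_of_norm_le`). [folklore] -/
theorem stub_sumRule :
    let Cfg : ℕ → Type := fun N => Config (N + 1) (Fin 3) T3
    let G := Torus.geometry (Fin 3)
    let ε : ℝ → ℕ → ℝ := hsDiameter
    let τ : ℝ → (N : ℕ) → Cfg N → ℝ≥0∞ := fun σ N z => Alexander.freeExitTime G (ε σ N) z
    let S : ℝ → (N : ℕ) → Cfg N → Cfg N := fun t _ z => freeFlight G t z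
    let zpre : ℝ → (N : ℕ) → Cfg N → ℕ → Cfg N := fun σ N z m =>
      let y := Alexander.stateAfter G (ε σ N) z m; S (τ σ N y).toReal N y
    let Kt : ℝ → (N : ℕ) → Cfg N → ℝ → ℕ := fun σ N z t => Alexander.collisionCount G (ε σ N) z t
    let hit : ℝ → (N : ℕ) → Cfg N → Fin (N + 1) → Fin (N + 1) → Prop := fun σ N y i j =>
      i < j ∧ y ∈ contactSet G (N + 1) (ε σ N) i j ∧ IsIncoming G y i j
    ∀ (a₀ θ₀ : T3 → ℝ) (u₀ : T3 → V3), Continuous a₀ → Continuous θ₀ → Continuous u₀ →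
      (∀ x, 0 < a₀ x) → (∀ x, 0 < θ₀ x) → ∀ σ : ℝ, 0 < σ → σ < 2⁻¹ →
      ∀ Φ : (N : ℕ) → HardSphereFlow G (ε σ N) (N + 1),
      let P := fun N => localGibbsLaw σ a₀ u₀ θ₀ N (Φ N)
      ∀ (t c : ℝ), 0 ≤ c → ∀ φ : ℕ → V3 → ℝ, (∀ N v, |φ N v| ≤ c * (1 + ‖v‖ ^ 2)) →
      ∃ C : ℝ, ∀ N : ℕ,
        |∫ z, ((N : ℝ) + 1) ^ (-(4 / 3 : ℝ)) * ∑ m ∈ Finset.range (Kt σ N z t),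
            ∑ i : Fin (N + 1), ∑ j : Fin (N + 1),
              (let y := zpre σ N z m
               if hit σ N y i j then
                 φ N ((collidePair G i j y i).2) + φ N ((collidePair G i j y j).2) -
                   φ N ((y i).2) - φ N ((y j).2)
               else 0) ∂(P N)| ≤ C * ((N : ℝ) + 1) ^ (-(1 / 3 : ℝ)) :=
  -- LANDED (p134649)
  Summit.AtomisticToContinuum.HydrodynamicLimit.Theorems.ContactAngleEquidistributionSketch.stub_sumRule

/-- STUB (v8) `psiT_measurable` — the collision-difference mark `ψ_T(s, x, v, w, n) := Dq_T(v, w, n̂)/(12|v − w|²)`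
(`Dq_T(v,w,ω) = q(v − ⟪v−w,ω⟫ω) + q(w + ⟪v−w,ω⟫ω) − q(v) − q(w)`, `q(v) = ⟪v, T v⟫`, `n̂ = |n|⁻¹ n`) is jointly
measurable. [folklore] -/
theorem stub_psiT_measurable (T : V3 →L[ℝ] V3) :
    let refl : V3 → V3 × V3 → V3 × V3 := fun n p =>
      (p.1 - ⟪p.1 - p.2, n⟫ • n, p.2 + ⟪p.1 - p.2, n⟫ • n)
    let Dq : V3 → V3 → V3 → ℝ := fun v w n =>
      ⟪(refl n (v, w)).1, T (refl n (v, w)).1⟫ + ⟪(refl n (v, w)).2, T (refl n (v, w)).2⟫ -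
        ⟪v, T v⟫ - ⟪w, T w⟫
    let ψ : ℝ → T3 → V3 → V3 → V3 → ℝ := fun _ _ v w n =>
      (12 * ‖v - w‖ ^ 2)⁻¹ * Dq v w (‖n‖⁻¹ • n)
    Measurable (fun p : ℝ × T3 × V3 × V3 × V3 => ψ p.1 p.2.1 p.2.2.1 p.2.2.2.1 p.2.2.2.2) :=
  -- LANDED (p134099)
  Summit.AtomisticToContinuum.HydrodynamicLimit.Theorems.ContactAngleEquidistributionSketch.stub_psiT_measurable T

/-- STUB (v8) `psiT_bound` — `|ψ_T| ≤ 1` when `‖T‖ ≤ 1` (`|Dq_T(v, w, ω)| ≤ 4|v − w|²` for `|ω| ≤ 1`; the value is `0`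
at `v = w` and at `n = 0`). [folklore] -/
theorem stub_psiT_bound (T : V3 →L[ℝ] V3) (hT : ‖T‖ ≤ 1) :
    let refl : V3 → V3 × V3 → V3 × V3 := fun n p =>
      (p.1 - ⟪p.1 - p.2, n⟫ • n, p.2 + ⟪p.1 - p.2, n⟫ • n)
    let Dq : V3 → V3 → V3 → ℝ := fun v w n =>
      ⟪(refl n (v, w)).1, T (refl n (v, w)).1⟫ + ⟪(refl n (v, w)).2, T (refl n (v, w)).2⟫ -
        ⟪v, T v⟫ - ⟪w, T w⟫
    let ψ : ℝ → T3 → V3 → V3 → V3 → ℝ := fun _ _ v w n =>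
      (12 * ‖v - w‖ ^ 2)⁻¹ * Dq v w (‖n‖⁻¹ • n)
    ∀ s x v w n, |ψ s x v w n| ≤ 1 :=
  -- LANDED (p133938)
  Summit.AtomisticToContinuum.HydrodynamicLimit.Theorems.ContactAngleEquidistributionSketch.stub_psiT_bound T hT

/-- STUB (v8) `psiT_lipschitz` — `ψ_T` is `1`-Lipschitz in the unit normal when `‖T‖ ≤ 1`
(`Dq_T(v, w, ·)` is `12|v − w|²`-Lipschitz on the unit sphere: it is `−c⟪g,Tω⟫ − c⟪ω,Tg⟫ + 2c²⟪ω,Tω⟫`,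
`c = ⟪g, ω⟫`). [folklore] -/
theorem stub_psiT_lipschitz (T : V3 →L[ℝ] V3) (hT : ‖T‖ ≤ 1) :
    let refl : V3 → V3 × V3 → V3 × V3 := fun n p =>
      (p.1 - ⟪p.1 - p.2, n⟫ • n, p.2 + ⟪p.1 - p.2, n⟫ • n)
    let Dq : V3 → V3 → V3 → ℝ := fun v w n =>
      ⟪(refl n (v, w)).1, T (refl n (v, w)).1⟫ + ⟪(refl n (v, w)).2, T (refl n (v, w)).2⟫ -
        ⟪v, T v⟫ - ⟪w, T w⟫
    let ψ : ℝ → T3 → V3 → V3 → V3 → ℝ := fun _ _ v w n =>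
      (12 * ‖v - w‖ ^ 2)⁻¹ * Dq v w (‖n‖⁻¹ • n)
    ∀ s x v w (n n' : V3), ‖n‖ = 1 → ‖n'‖ = 1 → |ψ s x v w n - ψ s x v w n'| ≤ ‖n - n'‖ :=
  -- LANDED (p134016)
  Summit.AtomisticToContinuum.HydrodynamicLimit.Theorems.ContactAngleEquidistributionSketch.stub_psiT_lipschitz T hT

/-- STUB (v8) `psiT_hit` — on a configuration of the torus with the pair `(i, j)` at contact (`|sepVec| = e > 0`),
the `|g|²`-weighted mark `ψ_T` read at the contact normal `ω = e⁻¹ sepVec(xᵢ, xⱼ)` IS the collisional change of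
`Σ ⟪v, T v⟫` over the pair divided by `12`: `collidePair` reflects the pair's velocities along `sepVec`
(`collidePair_apply_left/right`, `reflectVel`), and the reflection law is homogeneous of degree `0` in the
normal (`reflectVel_smul`). [folklore] -/
theorem stub_psiT_hit (T : V3 →L[ℝ] V3) {N : ℕ} {e : ℝ} (he : 0 < e)
    (y : Config (N + 1) (Fin 3) T3) {i j : Fin (N + 1)} (hij : i ≠ j)
    (hcontact : ‖(Torus.geometry (Fin 3)).sepVec (y i).1 (y j).1‖ = e) (s : ℝ) (x : T3) :
    let refl : V3 → V3 × V3 → V3 × V3 := fun n p =>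
      (p.1 - ⟪p.1 - p.2, n⟫ • n, p.2 + ⟪p.1 - p.2, n⟫ • n)
    let Dq : V3 → V3 → V3 → ℝ := fun v w n =>
      ⟪(refl n (v, w)).1, T (refl n (v, w)).1⟫ + ⟪(refl n (v, w)).2, T (refl n (v, w)).2⟫ -
        ⟪v, T v⟫ - ⟪w, T w⟫
    let ψ : ℝ → T3 → V3 → V3 → V3 → ℝ := fun _ _ v w n =>
      (12 * ‖v - w‖ ^ 2)⁻¹ * Dq v w (‖n‖⁻¹ • n)
    ‖(y i).2 - (y j).2‖ ^ 2 * ψ s x (y i).2 (y j).2 (e⁻¹ • (Torus.geometry (Fin 3)).sepVec (y i).1 (y j).1) =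
      12⁻¹ * (⟪(collidePair (Torus.geometry (Fin 3)) i j y i).2, T (collidePair (Torus.geometry (Fin 3)) i j y i).2⟫ +
        ⟪(collidePair (Torus.geometry (Fin 3)) i j y j).2, T (collidePair (Torus.geometry (Fin 3)) i j y j).2⟫ -
        ⟪(y i).2, T (y i).2⟫ - ⟪(y j).2, T (y j).2⟫) :=
  -- LANDED (p133975)
  Summit.AtomisticToContinuum.HydrodynamicLimit.Theorems.ContactAngleEquidistributionSketch.stub_psiT_hit T he y hij hcontact s x

/-- STUB (v8, lead) `velocityIsotropy` — **the crux forces asymptotic isotropy of the collision relative-velocity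
tensor** (certified necessary condition): if `ContactAngleEquidistribution` holds then for every family of
continuous profiles there is `σ₀ > 0` such that for `0 < σ < σ₀`, every `Φ`, `t ≥ 0` and every sequence of
operators `T_N` with `‖T_N‖ ≤ 1`, the normalised collision sum of the `κ_g`-MEANS of the collisional changes of
`Σᵢ ⟪vᵢ, T_N vᵢ⟫`, `(N+1)^{-4/3} E_{P_N} Σ_{coll ≤ t} ∫ Dq_{T_N}(vᵢ, vⱼ, normalize(−ĝ + ξ̂)) γ(dξ)`, tends to
`0` (crux at the admissible mark `ψ_{T_N}` minus `stub_sumRule` at `φ_N = ⟪·, T_N ·⟫/12`; the `κ_g`-mean is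
`(1/6)(|g|² tr T − 3⟪g, T g⟫)` on paper, whence "velocity isotropy"). [folklore] -/
theorem stub_velocityIsotropy (hCrux : ContactAngleEquidistribution) :
    let Cfg : ℕ → Type := fun N => Config (N + 1) (Fin 3) T3
    let G := Torus.geometry (Fin 3)
    let ε : ℝ → ℕ → ℝ := hsDiameter
    let τ : ℝ → (N : ℕ) → Cfg N → ℝ≥0∞ := fun σ N z => Alexander.freeExitTime G (ε σ N) z
    let S : ℝ → (N : ℕ) → Cfg N → Cfg N := fun t _ z => freeFlight G t z
    let ldir : V3 → V3 → V3 := fun ω ξ => ‖‖ω‖⁻¹ • ω + ‖ξ‖⁻¹ • ξ‖⁻¹ • (‖ω‖⁻¹ • ω + ‖ξ‖⁻¹ • ξ)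
    let zpre : ℝ → (N : ℕ) → Cfg N → ℕ → Cfg N := fun σ N z m =>
      let y := Alexander.stateAfter G (ε σ N) z m; S (τ σ N y).toReal N y
    let Kt : ℝ → (N : ℕ) → Cfg N → ℝ → ℕ := fun σ N z t => Alexander.collisionCount G (ε σ N) z t
    let hit : ℝ → (N : ℕ) → Cfg N → Fin (N + 1) → Fin (N + 1) → Prop := fun σ N y i j =>
      i < j ∧ y ∈ contactSet G (N + 1) (ε σ N) i j ∧ IsIncoming G y i j
    let refl : V3 → V3 × V3 → V3 × V3 := fun n p =>
      (p.1 - ⟪p.1 - p.2, n⟫ • n, p.2 + ⟪p.1 - p.2, n⟫ • n)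
    let Dq : (V3 →L[ℝ] V3) → V3 → V3 → V3 → ℝ := fun T v w n =>
      ⟪(refl n (v, w)).1, T (refl n (v, w)).1⟫ + ⟪(refl n (v, w)).2, T (refl n (v, w)).2⟫ -
        ⟪v, T v⟫ - ⟪w, T w⟫
    ∀ (a₀ θ₀ : T3 → ℝ) (u₀ : T3 → V3), Continuous a₀ → Continuous θ₀ → Continuous u₀ →
      (∀ x, 0 < a₀ x) → (∀ x, 0 < θ₀ x) → ∃ σ₀ : ℝ, 0 < σ₀ ∧ ∀ σ : ℝ, 0 < σ → σ < σ₀ →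
      ∀ Φ : (N : ℕ) → HardSphereFlow G (ε σ N) (N + 1),
      let P := fun N => localGibbsLaw σ a₀ u₀ θ₀ N (Φ N)
      ∀ t : ℝ, 0 ≤ t → ∀ T : ℕ → (V3 →L[ℝ] V3), (∀ N, ‖T N‖ ≤ 1) →
        Tendsto (fun N : ℕ => ∫ z, ((N : ℝ) + 1) ^ (-(4 / 3 : ℝ)) * ∑ m ∈ Finset.range (Kt σ N z t),
          ∑ i : Fin (N + 1), ∑ j : Fin (N + 1),
            (let y := zpre σ N z m
             if hit σ N y i j then
               ∫ ξ, Dq (T N) (y i).2 (y j).2 (ldir (-((y i).2 - (y j).2)) ξ) ∂(stdGaussian V3)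
             else 0) ∂(P N)) atTop (𝓝 0) :=
  -- LANDED (p134675)
  Summit.AtomisticToContinuum.HydrodynamicLimit.Theorems.ContactAngleEquidistributionSketch.stub_velocityIsotropy hCrux

end SumRule

/-! ## v8b (lead c5): the EXPLICIT `κ_g`-mean of the collisional change — `K_T = (|g|² tr T − 3⟪g, T g⟫)/6`

Moments of the cosine (Lambert) law `n = lambertDir ω ξ`, `ξ` standard Gaussian, `‖ω‖ = 1` (tree:
`…LambertianEulerSecondMoment.lambertDir_second_moment` `E⟪c,n⟫² = ¼(‖c‖² + ⟪c,ω⟫²)`, `…LambertLaw.lambertLaw`,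
`…Archimedes.archimedesV3`, the frame `Lambert.frameBasis`): the axial fourth moment `E⟪ω,n⟫⁴ = 1/3`, the weighted second
moment `E[⟪ω,n⟫²⟪c,n⟫²] = (‖c‖² + 3⟪c,ω⟫²)/12` and its polarisation, the mixed moment `E[⟪a,n⟫⟪c,n⟫] = ¼(⟪a,c⟫ + ⟪a,ω⟫⟪c,ω⟫)`,
the weighted quadratic form `E[⟪ω,n⟫²⟪n,Tn⟫] = tr T/12 + ⟪ω,Tω⟫/4`; whence, with `Dq_T = −c⟪g,Tn⟫ − c⟪n,Tg⟫ + 2c²⟪n,Tn⟫`,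
`c = ⟪g,n⟫ = −|g|⟪ω,n⟫` (`ω = −ĝ`): `∫ Dq_T(v, w, lambertDir(−g) ξ) dγ = (|g|² tr T − 3⟪g,Tg⟫)/6` and the EXPLICIT necessary
condition `stub_tracelessIsotropy`. -/

section KappaMean

/-- STUB (v8b) axial fourth moment of the cosine law: `E[⟪ω, lambertDir ω ξ⟫⁴] = 1/3` for a unit normal (Lambert law +
Archimedes: `½ ∫_{-1}^{1} 4 t₊ t⁴ dt = 1/3`). [folklore] -/
theorem stub_lambertFourthMoment_self {ω : V3} (hω : ‖ω‖ = 1) :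
    ∫ ξ, ⟪ω, lambertDir ω ξ⟫ ^ 4 ∂(stdGaussian V3) = 3⁻¹ :=
  -- LANDED (p135112)
  Summit.AtomisticToContinuum.HydrodynamicLimit.Theorems.ContactAngleEquidistributionSketch.stub_lambertFourthMoment_self hω

/-- STUB (v8b) weighted second moment of the cosine law: `E[⟪ω,n⟫² ⟪c,n⟫²] = (‖c‖² + 3⟪c,ω⟫²)/12` for a unit normal `ω`
(rotational symmetry about `ω` as in `secondMoment_unit`: axial value `1/3`, trace `E[⟪ω,n⟫²] = 1/2`, equal tangential values
`1/12`). [folklore] -/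
theorem stub_lambertWeightedMoment_unit {ω : V3} (hω : ‖ω‖ = 1) (c : V3) :
    ∫ ξ, ⟪ω, lambertDir ω ξ⟫ ^ 2 * ⟪c, lambertDir ω ξ⟫ ^ 2 ∂(stdGaussian V3) =
      12⁻¹ * (‖c‖ ^ 2 + 3 * ⟪c, ω⟫ ^ 2) :=
  -- LANDED (p135112)
  Summit.AtomisticToContinuum.HydrodynamicLimit.Theorems.ContactAngleEquidistributionSketch.stub_lambertWeightedMoment_unit hω c

/-- STUB (v8b) polarised weighted second moment: `E[⟪ω,n⟫² ⟪a,n⟫⟪c,n⟫] = (⟪a,c⟫ + 3⟪a,ω⟫⟪c,ω⟫)/12` (parallelogram identity on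
`stub_lambertWeightedMoment_unit`). [folklore] -/
theorem stub_lambertWeightedMixedMoment_unit {ω : V3} (hω : ‖ω‖ = 1) (a c : V3) :
    ∫ ξ, ⟪ω, lambertDir ω ξ⟫ ^ 2 * (⟪a, lambertDir ω ξ⟫ * ⟪c, lambertDir ω ξ⟫) ∂(stdGaussian V3) =
      12⁻¹ * (⟪a, c⟫ + 3 * (⟪a, ω⟫ * ⟪c, ω⟫)) :=
  -- LANDED (p135112)
  Summit.AtomisticToContinuum.HydrodynamicLimit.Theorems.ContactAngleEquidistributionSketch.stub_lambertWeightedMixedMoment_unit hω a c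

/-- STUB (v8b) mixed second moment of the cosine law: `E[⟪a,n⟫⟪c,n⟫] = ¼(⟪a,c⟫ + ⟪a,ω⟫⟪c,ω⟫)` for a unit normal `ω`
(polarisation of `lambertDir_second_moment`). [folklore] -/
theorem stub_lambertMixedMoment_unit {ω : V3} (hω : ‖ω‖ = 1) (a c : V3) :
    ∫ ξ, ⟪a, lambertDir ω ξ⟫ * ⟪c, lambertDir ω ξ⟫ ∂(stdGaussian V3) = 4⁻¹ * (⟪a, c⟫ + ⟪a, ω⟫ * ⟪c, ω⟫) :=
  -- LANDED (p134984)
  Summit.AtomisticToContinuum.HydrodynamicLimit.Theorems.ContactAngleEquidistributionSketch.stub_lambertMixedMoment_unit hω a c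

/-- STUB (v8b) weighted quadratic form of the cosine law: `E[⟪ω,n⟫² ⟪n, T n⟫] = tr T / 12 + ⟪ω, Tω⟫ / 4` for a unit normal
`ω` and every operator `T` (expand `⟪n,Tn⟫ = Σ_k ⟪b_k,n⟫⟪T†b_k,n⟫` in an orthonormal basis, `stub_lambertWeightedMixedMoment_unit`,
`LinearMap.trace_eq_sum_inner`). [folklore] -/
theorem stub_lambertWeightedQuadForm_unit {ω : V3} (hω : ‖ω‖ = 1) (T : V3 →L[ℝ] V3) :
    ∫ ξ, ⟪ω, lambertDir ω ξ⟫ ^ 2 * ⟪lambertDir ω ξ, T (lambertDir ω ξ)⟫ ∂(stdGaussian V3) =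
      12⁻¹ * LinearMap.trace ℝ V3 T.toLinearMap + 4⁻¹ * ⟪ω, T ω⟫ :=
  -- LANDED (p135420)
  Summit.AtomisticToContinuum.HydrodynamicLimit.Theorems.ContactAngleEquidistributionSketch.stub_lambertWeightedQuadForm_unit hω T

/-- STUB (v8b) **the `κ_g`-mean of the collisional change of a quadratic observable**: for every operator `T` and incoming
velocities `v, w` (`g = v − w`), `∫ Dq_T(v, w, lambertDir(−g) ξ) dγ(ξ) = (|g|² tr T − 3⟪g, T g⟫)/6` (`psiT_Dq_expand`:
`Dq_T = −c⟪g,Tn⟫ − c⟪n,Tg⟫ + 2c²⟪n,Tn⟫`, `c = ⟪g,n⟫ = −|g|⟪ω,n⟫` with `ω = −ĝ` and `lambertDir (−g) = lambertDir ω`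
(`lambertDir_smul_left`); `stub_lambertMixedMoment_unit` with the adjoint `T†`, `stub_lambertWeightedQuadForm_unit`; both sides
vanish at `g = 0`). [folklore] -/
theorem stub_kappaMean_Dq (T : V3 →L[ℝ] V3) (v w : V3) :
    let refl : V3 → V3 × V3 → V3 × V3 := fun n p =>
      (p.1 - ⟪p.1 - p.2, n⟫ • n, p.2 + ⟪p.1 - p.2, n⟫ • n)
    let Dq : V3 → V3 → V3 → ℝ := fun v w n =>
      ⟪(refl n (v, w)).1, T (refl n (v, w)).1⟫ + ⟪(refl n (v, w)).2, T (refl n (v, w)).2⟫ -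
        ⟪v, T v⟫ - ⟪w, T w⟫
    ∫ ξ, Dq v w (lambertDir (-(v - w)) ξ) ∂(stdGaussian V3) =
      6⁻¹ * (‖v - w‖ ^ 2 * LinearMap.trace ℝ V3 T.toLinearMap - 3 * ⟪v - w, T (v - w)⟫) :=
  -- LANDED (p135420)
  Summit.AtomisticToContinuum.HydrodynamicLimit.Theorems.ContactAngleEquidistributionSketch.stub_kappaMean_Dq T v w

/-- STUB (v8b, lead) `tracelessIsotropy` — **the explicit necessary condition**: if `ContactAngleEquidistribution` holds then for
every family of continuous profiles there is `σ₀ > 0` such that for `0 < σ < σ₀`, every `Φ`, `t ≥ 0` and operators `T_N`,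
`‖T_N‖ ≤ 1`: `(N+1)^{-4/3} E_{P_N} Σ_{coll ≤ t} (|g|² tr T_N − 3⟪g, T_N g⟫) → 0` — for traceless `T_N`, the `N^{4/3}`-normalised
second-moment tensor `Σ_{coll} g ⊗ g` of the collision relative velocities is asymptotically ISOTROPIC under the deterministically
evolved local Gibbs law (`stub_velocityIsotropy` + `stub_kappaMean_Dq`). [folklore] -/
theorem stub_tracelessIsotropy (hCrux : ContactAngleEquidistribution) :
    let Cfg : ℕ → Type := fun N => Config (N + 1) (Fin 3) T3
    let G := Torus.geometry (Fin 3)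
    let ε : ℝ → ℕ → ℝ := hsDiameter
    let τ : ℝ → (N : ℕ) → Cfg N → ℝ≥0∞ := fun σ N z => Alexander.freeExitTime G (ε σ N) z
    let S : ℝ → (N : ℕ) → Cfg N → Cfg N := fun t _ z => freeFlight G t z
    let zpre : ℝ → (N : ℕ) → Cfg N → ℕ → Cfg N := fun σ N z m =>
      let y := Alexander.stateAfter G (ε σ N) z m; S (τ σ N y).toReal N y
    let Kt : ℝ → (N : ℕ) → Cfg N → ℝ → ℕ := fun σ N z t => Alexander.collisionCount G (ε σ N) z t
    let hit : ℝ → (N : ℕ) → Cfg N → Fin (N + 1) → Fin (N + 1) → Prop := fun σ N y i j =>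
      i < j ∧ y ∈ contactSet G (N + 1) (ε σ N) i j ∧ IsIncoming G y i j
    ∀ (a₀ θ₀ : T3 → ℝ) (u₀ : T3 → V3), Continuous a₀ → Continuous θ₀ → Continuous u₀ →
      (∀ x, 0 < a₀ x) → (∀ x, 0 < θ₀ x) → ∃ σ₀ : ℝ, 0 < σ₀ ∧ ∀ σ : ℝ, 0 < σ → σ < σ₀ →
      ∀ Φ : (N : ℕ) → HardSphereFlow G (ε σ N) (N + 1),
      let P := fun N => localGibbsLaw σ a₀ u₀ θ₀ N (Φ N)
      ∀ t : ℝ, 0 ≤ t → ∀ T : ℕ → (V3 →L[ℝ] V3), (∀ N, ‖T N‖ ≤ 1) →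
        Tendsto (fun N : ℕ => ∫ z, ((N : ℝ) + 1) ^ (-(4 / 3 : ℝ)) * ∑ m ∈ Finset.range (Kt σ N z t),
          ∑ i : Fin (N + 1), ∑ j : Fin (N + 1),
            (let y := zpre σ N z m
             if hit σ N y i j then
               ‖(y i).2 - (y j).2‖ ^ 2 * LinearMap.trace ℝ V3 (T N).toLinearMap -
                 3 * ⟪(y i).2 - (y j).2, T N ((y i).2 - (y j).2)⟫
             else 0) ∂(P N)) atTop (𝓝 0) :=
  -- LANDED (p135504 (pending))
  Summit.AtomisticToContinuum.HydrodynamicLimit.Theorems.ContactAngleEquidistributionSketch.stub_tracelessIsotropy hCrux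

end KappaMean

/-! ## Composition (sorry-free): the stubs ⟹ the crux BY NAME -/

/-- **The crux from the stubs.** `θe := 1 + sup |θ₀|`, `σ₀ :=` the minimum of the five thresholds and
`1/2`; the crux functional splits pointwise as isolated-capped + near-field-capped + fast; the abstract
transfer lemma is fed with `stub_domination`, `stub_cost`, `stub_eqMoment`, `stub_nearField`, `stub_tail`
and the measurability of the four marked sums (`stub_meas`). -/
theorem ContactAngleEquidistribution_of : ContactAngleEquidistribution := by
  unfold ContactAngleEquidistribution
  intro Cfg G ε τ S ldir zpre Kt hit tcol xmid a₀ θ₀ u₀ ha hθ hu ha0 hθ0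
  -- the reference temperature `θe = Mθ + 1 > sup θ₀`
  obtain ⟨Mθ, hMθ0, hMθ⟩ := exists_forall_abs_le_of_continuous hθ
  have hθe : (0 : ℝ) < Mθ + 1 := by linarith
  have hθlt : ∀ x, θ₀ x < Mθ + 1 := fun x => by
    have := (le_abs_self _).trans (hMθ x)
    linarith
  -- the stubs
  obtain ⟨σ₁, hσ₁, h1⟩ := stub_cost (Mθ + 1) hθe
  obtain ⟨σ₃, hσ₃, h3⟩ := stub_domination a₀ θ₀ u₀ ha hθ hu ha0 hθ0 (Mθ + 1) hθlt
  obtain ⟨σ₄, hσ₄, h4⟩ := stub_nearField a₀ θ₀ u₀ ha hθ hu ha0 hθ0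
  have hT : CollisionMomentBound := stub_tail
  obtain ⟨σ₅, hσ₅, h5⟩ := hT a₀ θ₀ u₀ ha hθ hu ha0 hθ0
  have hM := stub_meas
  refine ⟨min (min σ₁ (min σ₃ σ₄)) (min σ₅ 2⁻¹),
    lt_min (lt_min hσ₁ (lt_min hσ₃ hσ₄)) (lt_min hσ₅ (by norm_num)), ?_⟩
  intro σ hσ hσlt Φ P t ht ψ hψm hψb hψl
  simp only [lt_min_iff] at hσlt
  obtain ⟨⟨hs1, hs3, hs4⟩, hs5, hsh⟩ := hσlt
  have hσhalf : σ ≤ 1 / 2 := by rw [one_div]; exact hsh.le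
  have hPprob : ∀ N, IsProbabilityMeasure (P N) := fun N =>
    isProbabilityMeasure_localGibbsLaw ha hθ hu ha0 hθ0 hσhalf N (Φ N)
  have hQprob : ∀ N, IsProbabilityMeasure
      (localGibbsLaw σ (fun _ => 1) (fun _ => 0) (fun _ => Mθ + 1) N (Φ N)) := fun N =>
    isProbabilityMeasure_localGibbsLaw continuous_const continuous_const continuous_const
      (fun _ => one_pos) (fun _ => hθe) hσhalf N (Φ N)
  obtain ⟨C, hC⟩ := h3 σ hσ hs3
  -- local names for the marks (same shape as in the stubs' `let` chains)
  let cen : (N : ℕ) → ℝ → Cfg N → Fin (N + 1) → Fin (N + 1) → ℝ := fun N s y i j =>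
    ψ N s (xmid N y i j) (y i).2 (y j).2 ((ε σ N)⁻¹ • G.sepVec (y i).1 (y j).1) -
      ∫ ξ, ψ N s (xmid N y i j) (y i).2 (y j).2 (ldir (-((y i).2 - (y j).2)) ξ) ∂(stdGaussian V3)
  let near : (N : ℕ) → Cfg N → Fin (N + 1) → Fin (N + 1) → Prop := fun N y i j =>
    ∃ k : Fin (N + 1), k ≠ i ∧ k ≠ j ∧ ‖G.sepVec (y k).1 (xmid N y i j)‖ ≤ 3 * ε σ N
  let markA : ℝ → (N : ℕ) → ℝ → Cfg N → Fin (N + 1) → Fin (N + 1) → ℝ := fun V N s y i j =>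
    if near N y i j then 0 else if V < ‖(y i).2 - (y j).2‖ then 0 else
      ‖(y i).2 - (y j).2‖ ^ 2 * cen N s y i j
  let markB : ℝ → (N : ℕ) → ℝ → Cfg N → Fin (N + 1) → Fin (N + 1) → ℝ := fun V N s y i j =>
    if near N y i j then (if V < ‖(y i).2 - (y j).2‖ then 0 else
      ‖(y i).2 - (y j).2‖ ^ 2 * cen N s y i j) else 0
  let markR : ℝ → (N : ℕ) → ℝ → Cfg N → Fin (N + 1) → Fin (N + 1) → ℝ := fun V N s y i j =>
    if V < ‖(y i).2 - (y j).2‖ then ‖(y i).2 - (y j).2‖ ^ 2 * cen N s y i j else 0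
  let markW : (N : ℕ) → ℝ → Cfg N → Fin (N + 1) → Fin (N + 1) → ℝ := fun N _ y i j =>
    1 + ‖((y i).2 - (y j).2)‖ ^ 3
  -- measurability of the marks
  have hcen : ∀ N (i j : Fin (N + 1)), Measurable fun p : ℝ × Cfg N => cen N p.1 p.2 i j :=
    fun N i j => (measurable_markPsi (hψm N) _ i j).sub (measurable_markAvg (hψm N) i j)
  have hnear : ∀ N (i j : Fin (N + 1)), MeasurableSet {p : ℝ × Cfg N | near N p.2 i j} :=
    fun N i j => measurableSet_nearBall _ i j
  have hg : ∀ N (i j : Fin (N + 1)), Measurable fun p : ℝ × Cfg N => ‖(p.2 i).2 - (p.2 j).2‖ :=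
    fun N i j => ((measurable_vel₂ i).sub (measurable_vel₂ j)).norm
  have hcap : ∀ V N (i j : Fin (N + 1)), MeasurableSet {p : ℝ × Cfg N | V < ‖(p.2 i).2 - (p.2 j).2‖} :=
    fun V N i j => measurableSet_lt measurable_const (hg N i j)
  have hmA : ∀ V N (i j : Fin (N + 1)), Measurable fun p : ℝ × Cfg N => markA V N p.1 p.2 i j :=
    fun V N i j => Measurable.ite (hnear N i j) measurable_const
      (Measurable.ite (hcap V N i j) measurable_const (((hg N i j).pow_const 2).mul (hcen N i j)))
  have hmB : ∀ V N (i j : Fin (N + 1)), Measurable fun p : ℝ × Cfg N => markB V N p.1 p.2 i j :=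
    fun V N i j => Measurable.ite (hnear N i j)
      (Measurable.ite (hcap V N i j) measurable_const (((hg N i j).pow_const 2).mul (hcen N i j)))
      measurable_const
  have hmR : ∀ V N (i j : Fin (N + 1)), Measurable fun p : ℝ × Cfg N => markR V N p.1 p.2 i j :=
    fun V N i j => Measurable.ite (hcap V N i j) (((hg N i j).pow_const 2).mul (hcen N i j))
      measurable_const
  have hmW : ∀ N (i j : Fin (N + 1)), Measurable fun p : ℝ × Cfg N => markW N p.1 p.2 i j :=
    fun N i j => measurable_const.add ((hg N i j).pow_const 3)
  -- the centred mark is bounded by 2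
  have hd : ∀ N s (y : Cfg N) (i j : Fin (N + 1)), |cen N s y i j| ≤ 2 := fun N s y i j =>
    abs_sub_avg_le_two _ (ψ N) (hψb N) _ _ _ _ _ _
  -- the normalisation is nonnegative
  have hc : ∀ N : ℕ, (0 : ℝ) ≤ ((N : ℝ) + 1) ^ (-(4 / 3 : ℝ)) := fun N => by positivity
  refine stub_abstractDV (fun N => P N)
    (fun N => localGibbsLaw σ (fun _ => 1) (fun _ => 0) (fun _ => Mθ + 1) N (Φ N)) hPprob hQprob _ _ _ _
    (fun V N z => ((N : ℝ) + 1) ^ (-(4 / 3 : ℝ)) * ∑ m ∈ Finset.range (Kt σ N z t),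
      ∑ i : Fin (N + 1), ∑ j : Fin (N + 1),
        (let y := zpre σ N z m
         if hit σ N y i j then markR V N (tcol σ N z m) y i j else 0))
    ?_ ?_ ?_ ?_ ?_ ?_ (h5 σ hσ hs5 Φ t ht) ?_ ?_ ?_ ⟨C, fun N => hC N (Φ N)⟩
    (fun V hV => h1 σ hσ hs1 Φ t ht V hV ψ hψm hψb hψl)
    (fun V hV => h4 σ hσ hs4 Φ t ht V hV ψ hψm hψb hψl)
  · -- hD : the pointwise three-way split
    intro V hV N z
    exact mul_sum3_split _ _ _ _ _ _ _ fun m i j => ite_split3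
  · -- hAm
    intro V hV N
    exact (hM σ hσ hsh N t (fun s y i j => markA V N s y i j) fun i j => hmA V N i j).const_mul _
  · -- hBm
    intro V hV N
    exact (hM σ hσ hsh N t (fun s y i j => markB V N s y i j) fun i j => hmB V N i j).const_mul _
  · -- hRm
    intro V hV N
    exact (hM σ hσ hsh N t (fun s y i j => markR V N s y i j) fun i j => hmR V N i j).const_mul _
  · -- hWm
    intro N
    exact (hM σ hσ hsh N t (fun s y i j => markW N s y i j) fun i j => hmW N i j).const_mul _
  · -- hW0
    intro N z
    exact mul_sum3_nonneg _ _ (hc N) _ fun m i j => termW_nonneg (norm_nonneg _)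
  · -- hAW
    intro V hV N z
    exact abs_mul_sum3_le _ _ (hc N) 2 _ _ fun m i j =>
      termA_le_W (norm_nonneg _) (hd N _ _ i j)
  · -- hBW
    intro V hV N z
    exact abs_mul_sum3_le _ _ (hc N) 2 _ _ fun m i j =>
      termB_le_W (norm_nonneg _) (hd N _ _ i j)
  · -- hRW
    intro V hV N z
    exact abs_mul_sum3_le _ _ (hc N) (2 / V) _ _ fun m i j =>
      termR_le_W hV (norm_nonneg _) (hd N _ _ i j) fun h => h


end Summit.AtomisticToContinuum.HydrodynamicLimit.Cruxes.ContactAngleEquidistribution.Sketch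

end
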